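import Mathlib

/-!
# Line `negsquares` — the e-free INFLECTION LAW `IB(m,K)` of the commuting sector (crux `MatrixDescartes`, stmt-18050)

Ideator seat `val-idea-6`, generations 10–12 (v1.3: §7 added by gen 12).  **v1.0 (gen 11) = the tilt-pencil / inflection-law sections of
`Lines/negsquares_tropical.lean` v2.0–v2.1, MOVED here verbatim, plus the gen-11 additions** (that file reached the crux-workfile
size cap; it keeps the tropical skeleton, `OneLawSharp`, Prop. E, the window/gap laws and their refutation record, and now points here).
HONEST FRAME: `VP ≠ VNP`, conjecture B and the crux `MatrixDescartes` are not touched by anything in this file; stmt-18050 stays OPEN;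
the file has NO `sorry` and registers nothing.

SELF-CONTAINED: the `Cruxes/…/Lines` modules are not importable on the farm, so §0 below REPEATS VERBATIM (same tokens, namespace
`NegSquaresInflection` instead of `NegSquaresTropical`) the commuting-sector basics of `negsquares_tropical.lean` ll. 548–758 and 902–926:
`letterPoly`, `tiltPoly`, `critPoly`, `commDet`, `posRoots`, `CommCriticalBudget` (CKB), `CommOneLawSharp` (COMM-L1), `tiltPoly_eq`,
Prop. E (`X_mul_wronskian_commDet`, `posRoots_commDet_le_succ`, `commOneLawSharp_of_commCriticalBudget`), `letterPoly_eval(_pos)`, `coprodSq_eval_pos`.  Every statement below is therefore,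
token for token, a statement about the objects of that file; when the Lines modules become importable the copies are to be replaced by an import.

Contents (all kernel-checked):
* §0 the commuting-sector basics (copied);
* §1 the TILT PENCIL `S_e = S_0 − e·A` (`critPoly_pencil`), Rolle for the pencil (`posRoots_pencil_le_succ`), the e-free inflection Wronskian
  `inflWronskian`, the located law `InflectionBudget m K` (IB) and its unconditional kernel edges IB ⇒ CKB ⇒ COMM-L1
  (`commCriticalBudget_of_inflectionBudget`, `commOneLawSharp_of_inflectionBudget`) — v2.0 of the companion file;
* §2 the SUM-LETTER form at `m = 2` (`sumLetterExcess`, `X_mul_inflWronskian_two`, `inflectionBudget_two_iff`) — v2.1;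
* §3 (gen 11) the sum-letter form for EVERY `m` (`coprodSum = e_{m−1}(q)`, `lagVar_mul`, `lagVar_prod`, `X_mul_inflWronskian_gen`,
  `inflectionBudget_iff_sumLetter`): IB(m,K) ⇔ «the variance profile of `e_{m−1}(q)` exceeds the sum of the letters' variance profiles at most
  `2(m−1)(K−1)` times on `(0,∞)`» (val-idea-crit-2 #47 P3);
* §4 (gen 11) **THEOREM IB(m,2) for every `m`** (`inflectionBudget_K_two`; hence `commCriticalBudget_K_two`, `commOneLawSharp_K_two`) by POLE
  COUNTING: after `u = X^{d₁−d₀}` the letters are linear, `Σ 1/qᵢ = Σ_c w_c/(u + α_c)` is a Stieltjes function, and the excess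
  `Ê = lagVar P̂·Π̂² − P̂²·lagVar Π̂` has degree `≤ 4s+1`, a root at `0`, and `2s` sign changes on `(−∞,0)` forced at the `s+1` poles (`Ê > 0`) and at the
  `s` interlacing zeros of `P̂` (`Ê < 0`, since `P̂' = Π̂·G̃' ≠ 0` there) — so at most `2s = 2(m−1)(K−1)` positive roots (`posRoots_EE_poleSum_le`,
  `posRoots_EE_finset_le`; coincident ratios through the gauge identity `EE (M·P) (M·Q) = M⁴·EE P Q`, `posRoots_EE_linear`).
  The argument uses real-rootedness of the `u`-letters and is NOT available at `K ≥ 3`; REACH toward stmt-18050 is `m ≥ 3, K ≥ 3` only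
  (statement of record IB(3,3) «≤ 8» ⇒ CKB(3,3) «≤ 9» ⇒ COMM(3,3) «≤ 10»); first exact target IB(2,3) at `d = (0,1,2)` — OPEN;
* §5 (gen 11, v1.1) SUPPORT AFFINITIES and BOUNDARY ROWS: the count is invariant under `d ↦ c + N·d` (`posRoots_inflWronskian_affine`), so every
  arithmetic-progression support is the dense cell (`posRoots_inflWronskian_AP_three`); the exact variance identity `eval_lagVar_letterPoly`
  (Lagrange) and the boundary theorems `inflectionBudget_K_zero/K_one/m_zero/m_one`, packaged as `inflectionBudget_of_boundary : m ≤ 1 ∨ K ≤ 2 → IB m K`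
  — the proved region is exactly `m ≤ 1 ∨ K ≤ 2`, the located region `m ≥ 2 ∧ K ≥ 3`;
* §6 (gen 11, v1.2) the kernel face of the BOUNDARY-PHASE PARITY at `K = 3` (memo §17.3): the generic lemma
  `posRoots_le_natDegree_sub_one_of_odd` (odd degree, both end coefficients negative ⇒ fewer positive roots than the degree) and, for
  two positive quadratics, the ray polynomial `rayF` (explicit expansion `rayF_eq`, end coefficients `rayF_coeff_zero/five`) with
  `posRoots_rayF_le : posRoots (rayF a b c) ≤ 4` = BPL-AP(2,3).  On AP supports memo §17 turns this into the PAPER theorem IB±(m,3)-AP via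
  two classical analytic inputs (Aronszajn–Donoghue, Schoenberg) that are not kernel material here.
* §7 (gen 12, v1.3) the MEAN-CROSSING LAW `MeanCrossingLaw K` («MC(K)»: the Euler–Wronskian `meanWr q₀ q₁ = θq₀·q₁ − q₀·θq₁` of two positive
  letters has at most `K − 2` distinct positive roots, i.e. the tilted means cross at most `K − 2` times) with the THEOREMS `meanCrossingLaw_two`
  and `meanCrossingLaw_three` (every support; Descartes on the three ordered pair-sums — the first SPARSITY-SENSITIVE kernel lemma of the line),
  the BALANCE FORM `sumLetterExcess_eq_balance : E = q₀q₁·W² − (q₀+q₁)(q₁³Λq₀ + q₀³Λq₁)` (law of total variance) and its corollary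
  `meanWr_eval_ne_zero_of_excess_pos` (islands of `{H'' > 0}` lie in `{m₀ ≠ m₁}`).  Memo `negsquares-kink.md` §19: the decoupled three-letter law is
  REFUTED (certified); `MC(K)` is a THEOREM ON PAPER for every `K` (the LAP LAW, via total positivity / ECT-systems — classical analysis that is not
  kernel material here, like §6's inputs); `MC` alone does not give IB (two islands per lap occur).
-/

set_option linter.dupNamespace false

namespace Summit.ValiantsHypothesis.ValiantsHypothesis.Cruxes.MatrixDescartes.NegSquaresInflection

open Polynomial Finset
open scoped BigOperators

/-! ### §0 — the commuting-sector basics (VERBATIM COPY of `negsquares_tropical.lean` ll. 548–758; see the module note) -/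

section Commuting

variable {m K : ℕ}

/-- The `i`-th letter polynomial `q i = Σ_l p l i · X^{d l}` of a diagonal (commuting) letter family
`P l = diagonal (p l)`. -/
noncomputable def letterPoly (d : Fin K → ℕ) (p : Fin K → Fin m → ℝ) (i : Fin m) : ℝ[X] :=
  ∑ l, C (p l i) * X ^ d l

/-- The tilt `r i = Σ_l (d l − e) · p l i · X^{d l}` (REAL coefficient `d l − e`, no natural subtraction);
`tiltPoly_eq`: `r i = X · (q i)' − e · q i`. -/
noncomputable def tiltPoly (d : Fin K → ℕ) (e : ℕ) (p : Fin K → Fin m → ℝ) (i : Fin m) : ℝ[X] :=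
  ∑ l, C (((d l : ℝ) - e) * p l i) * X ^ d l

/-- The critical polynomial `S = Σ_i r i · Π_{j ≠ i} (q j)²`: `sign σ'(log t) = −sign S(t)` for `σ = Σ_i X^e / q i`
(memo §0), so the distinct positive roots of `S` are the critical points of `σ`. -/
noncomputable def critPoly (d : Fin K → ℕ) (e : ℕ) (p : Fin K → Fin m → ℝ) : ℝ[X] :=
  ∑ i, tiltPoly d e p i * ∏ j ∈ Finset.univ.erase i, letterPoly d p j ^ 2

/-- The commuting `κ = 1` determinant `N = Π_i q i − X^e · Σ_i Π_{j ≠ i} q j`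
(`= det (diagonal q − X^e • 11ᵀ)` by the matrix-determinant lemma; `w` absorbed into the letters). -/
noncomputable def commDet (d : Fin K → ℕ) (e : ℕ) (p : Fin K → Fin m → ℝ) : ℝ[X] :=
  ∏ i, letterPoly d p i - X ^ e * ∑ i, ∏ j ∈ Finset.univ.erase i, letterPoly d p j

/-- Number of DISTINCT positive roots — the count used in `OneLawSharp`. -/
noncomputable def posRoots (f : ℝ[X]) : ℕ := (f.roots.toFinset.filter (fun t => 0 < t)).card

/-- **CKB(m,K) — the commuting critical budget (located conjecture; memo `negsquares-kink.md` §1, §6).**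
For strictly increasing natural exponents and POSITIVE diagonal letters, the critical polynomial has at most
`2(m−1)(K−1) + 1` distinct positive roots — i.e. `σ = Σ_i X^e/q i` has at most `(m−1)(K−1) + 1` local maxima
(«kink budget»: a theorem in the tropical model, memo Thm A; proved for `K ≤ 2` by degree, memo §4; OPEN from
`(m,K) = (2,3)` on as a structural statement and from `(3,3)` on even numerically-vs-Descartes: memo §6 table).
`CommCriticalBudget m K → CommOneLawSharp m K` is memo Prop. E (Rolle; prover-sized, not formalised here). -/
def CommCriticalBudget (m K : ℕ) : Prop :=
  ∀ (d : Fin K → ℕ) (e : ℕ) (p : Fin K → Fin m → ℝ), StrictMono d → (∀ l i, 0 < p l i) →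
    posRoots (critPoly d e p) ≤ 2 * (m - 1) * (K - 1) + 1

/-- **COMM-L1(m,K)** — the located sharp law `OneLawSharp` restricted to positive diagonal letters (`w = 1`):
`Z₊(Π q − X^e Σ_i Π_{j≠i} q j) ≤ 2(m−1)(K−1) + 2`.  Known: `m ≤ 2` (all `K`), `K ≤ 2` (all `m`); first open cell `(3,3)`
(«COMM(3,3) ≤ 10», Descartes gives `12`). -/
def CommOneLawSharp (m K : ℕ) : Prop :=
  ∀ (d : Fin K → ℕ) (e : ℕ) (p : Fin K → Fin m → ℝ), StrictMono d → (∀ l i, 0 < p l i) →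
    posRoots (commDet d e p) ≤ 2 * (m - 1) * (K - 1) + 2

/-- L1's constant is twice the kink budget (memo Thm A: `budget = (m−1)(K−1)+1`; two crossings per maximum). -/
theorem commL1_eq_two_budget (m K : ℕ) : 2 * (m - 1) * (K - 1) + 2 = 2 * ((m - 1) * (K - 1) + 1) := by ring

/-- The tilt is `X · q' − e · q`. -/
theorem tiltPoly_eq (d : Fin K → ℕ) (e : ℕ) (p : Fin K → Fin m → ℝ) (i : Fin m) :
    tiltPoly d e p i = X * derivative (letterPoly d p i) - C (e : ℝ) * letterPoly d p i := by
  unfold tiltPoly letterPoly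
  rw [derivative_sum, Finset.mul_sum, Finset.mul_sum, ← Finset.sum_sub_distrib]
  refine Finset.sum_congr rfl fun l _ => ?_
  rw [derivative_C_mul_X_pow]
  rcases Nat.eq_zero_or_pos (d l) with h | h
  · rw [h]
    simp only [pow_zero, Nat.cast_zero, mul_zero, map_zero, zero_mul, mul_one, mul_zero, zero_sub, map_mul,
      map_neg, map_natCast]
    ring
  · obtain ⟨k, hk⟩ : ∃ k, d l = k + 1 := ⟨d l - 1, (Nat.succ_pred_eq_of_pos h).symm⟩
    rw [hk, Nat.add_sub_cancel]
    simp only [map_mul, map_sub, map_natCast, Nat.cast_add, Nat.cast_one]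
    ring

/-- `m = 0`: no letters, `S = 0`, no roots — the budget holds vacuously-in-content but honestly-in-kernel. -/
theorem commCriticalBudget_zero (K : ℕ) : CommCriticalBudget 0 K := by
  intro d e p _ _
  simp [posRoots, critPoly]

/-! ### Prop. E in kernel (v1.3): `X·(N'·Πq − N·(Πq)') = X^e·S` and, by Rolle, `Z₊(N) ≤ Z₊(S) + 1`;
hence **CKB ⇒ COMM-L1**.  The algebra uses, for EACH `i`, the factorisation `Πq = q i · Π_{j≠i} q j` — no double sums. -/

/-- `(Σ_i Π_{j≠i} q j) · Π q = Σ_i q i · (Π_{j≠i} q j)²`. -/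
theorem sum_coprod_mul_prod (q : Fin m → ℝ[X]) :
    (∑ i, ∏ j ∈ univ.erase i, q j) * ∏ i, q i = ∑ i, q i * (∏ j ∈ univ.erase i, q j) ^ 2 := by
  rw [Finset.sum_mul]
  refine Finset.sum_congr rfl fun i _ => ?_
  rw [← Finset.mul_prod_erase univ q (mem_univ i)]
  ring

/-- Wronskian identity `T·A' − T'·A = Σ_i (q i)'·(Π_{j≠i} q j)²` for `A = Π q`, `T = Σ_i Π_{j≠i} q j`. -/
theorem sum_coprod_wronskian (q : Fin m → ℝ[X]) :
    (∑ i, ∏ j ∈ univ.erase i, q j) * derivative (∏ i, q i)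
      - derivative (∑ i, ∏ j ∈ univ.erase i, q j) * ∏ i, q i
      = ∑ i, derivative (q i) * (∏ j ∈ univ.erase i, q j) ^ 2 := by
  rw [derivative_sum, Finset.sum_mul, Finset.sum_mul, ← Finset.sum_sub_distrib]
  refine Finset.sum_congr rfl fun i _ => ?_
  have hA : ∏ j, q j = q i * ∏ j ∈ univ.erase i, q j := (Finset.mul_prod_erase univ q (mem_univ i)).symm
  rw [hA, derivative_mul]
  ring

theorem X_mul_C_mul_X_pow_pred (e : ℕ) : (X : ℝ[X]) * (C (e : ℝ) * X ^ (e - 1)) = C (e : ℝ) * X ^ e := by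
  rcases Nat.eq_zero_or_pos e with rfl | he
  · simp
  · obtain ⟨k, rfl⟩ : ∃ k, e = k + 1 := ⟨e - 1, (Nat.succ_pred_eq_of_pos he).symm⟩
    rw [Nat.add_sub_cancel, pow_succ]
    ring

/-- **Prop. E, algebraic half (memo `negsquares-kink.md` §1):** `X · (N'·Πq − N·(Πq)') = X^e · S`
for `N = commDet`, `S = critPoly` — no positivity needed, an identity in `ℝ[X]`. -/
theorem X_mul_wronskian_commDet (d : Fin K → ℕ) (e : ℕ) (p : Fin K → Fin m → ℝ) :
    X * (derivative (commDet d e p) * ∏ i, letterPoly d p i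
        - commDet d e p * derivative (∏ i, letterPoly d p i))
      = X ^ e * critPoly d e p := by
  have h1 := sum_coprod_mul_prod (letterPoly d p)
  have h2 := sum_coprod_wronskian (letterPoly d p)
  have h5 := X_mul_C_mul_X_pow_pred e
  have h3 : critPoly d e p
      = X * ∑ i, derivative (letterPoly d p i) * (∏ j ∈ univ.erase i, letterPoly d p j) ^ 2
        - C (e : ℝ) * ∑ i, letterPoly d p i * (∏ j ∈ univ.erase i, letterPoly d p j) ^ 2 := by
    simp only [critPoly, tiltPoly_eq, Finset.mul_sum, ← Finset.sum_sub_distrib, Finset.prod_pow]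
    refine Finset.sum_congr rfl fun i _ => ?_
    ring
  have h4 : derivative (commDet d e p)
      = derivative (∏ i, letterPoly d p i)
        - (C (e : ℝ) * X ^ (e - 1) * ∑ i, ∏ j ∈ univ.erase i, letterPoly d p j
            + X ^ e * derivative (∑ i, ∏ j ∈ univ.erase i, letterPoly d p j)) := by
    unfold commDet
    rw [derivative_sub, derivative_mul, derivative_X_pow]
  rw [h3, h4]
  unfold commDet
  linear_combination (-(C (e : ℝ) * X ^ e)) * h1 + X ^ (e + 1) * h2
    + (-((∑ i, ∏ j ∈ univ.erase i, letterPoly d p j) * ∏ i, letterPoly d p i)) * h5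

/-- **Prop. E (memo §1), analytic half — Rolle.**  If the product of the letters is positive on `(0,∞)` then
`Z₊(N) ≤ Z₊(S) + 1` (distinct positive roots; the case `S = 0` is handled: then `N/Πq` is constant on `(0,∞)`
and a nonzero `N` has no positive root). -/
theorem posRoots_commDet_le_succ (d : Fin K → ℕ) (e : ℕ) (p : Fin K → Fin m → ℝ)
    (hA : ∀ t : ℝ, 0 < t → 0 < (∏ i, letterPoly d p i).eval t) :
    posRoots (commDet d e p) ≤ posRoots (critPoly d e p) + 1 := by
  classical
  have hid := X_mul_wronskian_commDet d e p
  set N := commDet d e p with hN_def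
  set A := ∏ i, letterPoly d p i with hA_def
  set S := critPoly d e p with hS_def
  have hf : ∀ t : ℝ, 0 < t → HasDerivAt (fun u => N.eval u / A.eval u)
      ((N.derivative.eval t * A.eval t - N.eval t * A.derivative.eval t) / (A.eval t) ^ 2) t :=
    fun t ht => (N.hasDerivAt t).div (A.hasDerivAt t) (hA t ht).ne'
  have hcont : ∀ a b : ℝ, 0 < a → ContinuousOn (fun u => N.eval u / A.eval u) (Set.Icc a b) :=
    fun a b ha => N.continuousOn.div A.continuousOn fun u hu => (hA u (ha.trans_le hu.1)).ne'
  have key : ∀ c : ℝ, 0 < c →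
      N.derivative.eval c * A.eval c - N.eval c * A.derivative.eval c = 0 → S.eval c = 0 := by
    intro c hc h
    have h2 := congrArg (eval c) hid
    simp only [eval_mul, eval_X, eval_sub, eval_pow, h, mul_zero] at h2
    exact (mul_eq_zero.mp h2.symm).resolve_left (pow_ne_zero _ hc.ne')
  by_cases hN : N = 0
  · simp [posRoots, hN]
  by_cases hS : S = 0
  · have hW : derivative N * A - N * derivative A = 0 := by
      have h0 : (X : ℝ[X]) * (derivative N * A - N * derivative A) = 0 := by rw [hid, hS, mul_zero]
      exact (mul_eq_zero.mp h0).resolve_left X_ne_zero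
    have hf0 : ∀ t : ℝ, 0 < t → HasDerivAt (fun u => N.eval u / A.eval u) 0 t := by
      intro t ht
      have hWt : N.derivative.eval t * A.eval t - N.eval t * A.derivative.eval t = 0 := by
        have := congrArg (eval t) hW
        simpa only [eval_sub, eval_mul, eval_zero] using this
      have := hf t ht
      rwa [hWt, zero_div] at this
    have hnoroot : ∀ x : ℝ, 0 < x → N.eval x = 0 → ∀ u : ℝ, 0 < u → N.eval u = 0 := by
      intro x hx hxr u hu
      have hfx : N.eval x / A.eval x = 0 := by rw [hxr, zero_div]
      have hfu : N.eval u / A.eval u = 0 := by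
        rcases le_total x u with hxu | hux
        · have hc := constant_of_has_deriv_right_zero (hcont x u hx)
            (fun t ht => (hf0 t (hx.trans_le ht.1)).hasDerivWithinAt) u ⟨hxu, le_rfl⟩
          rw [hc, hfx]
        · have hc := constant_of_has_deriv_right_zero (hcont u x hu)
            (fun t ht => (hf0 t (hu.trans_le ht.1)).hasDerivWithinAt) x ⟨hux, le_rfl⟩
          rw [← hc, hfx]
      rcases div_eq_zero_iff.mp hfu with h | h
      · exact h
      · exact absurd h (hA u hu).ne'
    have hempty : (N.roots.toFinset.filter fun t => 0 < t) = ∅ := by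
      refine Finset.filter_eq_empty_iff.mpr fun x hx hx0 => hN ?_
      rw [Multiset.mem_toFinset, mem_roots hN] at hx
      refine Polynomial.eq_zero_of_infinite_isRoot N ((Set.Ioi_infinite (0 : ℝ)).mono fun u hu => ?_)
      exact hnoroot x hx0 hx u hu
    simp [posRoots, hempty]
  · refine Finset.card_le_of_interleaved fun x hx y hy hxy _ => ?_
    simp only [Finset.mem_filter, Multiset.mem_toFinset, mem_roots hN, IsRoot.def] at hx hy
    obtain ⟨c, hc, hc'⟩ := exists_deriv_eq_zero (f := fun u => N.eval u / A.eval u) hxy (hcont x y hx.2)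
      (by rw [hx.1, hy.1, zero_div, zero_div])
    have hc0 : 0 < c := hx.2.trans hc.1
    refine ⟨c, ?_, hc.1, hc.2⟩
    simp only [Finset.mem_filter, Multiset.mem_toFinset, mem_roots hS, IsRoot.def]
    refine ⟨key c hc0 ?_, hc0⟩
    have hd := (hf c hc0).deriv
    rw [hc'] at hd
    rcases div_eq_zero_iff.mp hd.symm with h | h
    · exact h
    · exact absurd (pow_eq_zero_iff two_ne_zero |>.mp h) (hA c hc0).ne'

/-- Positive letters have a positive product on `(0,∞)` (needs `K ≥ 1`; for `K = 0` every letter is `0`). -/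
theorem prod_letterPoly_eval_pos (d : Fin K → ℕ) (p : Fin K → Fin m → ℝ) (hK : 0 < K)
    (hp : ∀ l i, 0 < p l i) {t : ℝ} (ht : 0 < t) : 0 < (∏ i, letterPoly d p i).eval t := by
  rw [eval_prod]
  refine Finset.prod_pos fun i _ => ?_
  simp only [letterPoly, eval_finsetSum, eval_mul, eval_C, eval_pow, eval_X]
  haveI : Nonempty (Fin K) := ⟨⟨0, hK⟩⟩
  exact Finset.sum_pos (fun l _ => mul_pos (hp l i) (pow_pos ht _)) Finset.univ_nonempty

/-- **CKB ⇒ COMM-L1 (memo Prop. E, in kernel): the commuting located one-law follows from the critical budget**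
(`K ≥ 1`; `K = 0` has no letters).  In particular `CommCriticalBudget 3 3` («`Z₊(S) ≤ 9`») gives COMM(3,3) `≤ 10`. -/
theorem commOneLawSharp_of_commCriticalBudget (hK : 0 < K) (h : CommCriticalBudget m K) :
    CommOneLawSharp m K := by
  intro d e p hd hp
  have h1 := posRoots_commDet_le_succ d e p fun t ht => prod_letterPoly_eval_pos d p hK hp ht
  have h2 := h d e p hd hp
  omega


/-! (§0 continued — copied from ll. 902–926: evaluation / positivity of letters and co-product weights) -/

/-- Evaluation of a letter: `q i (t) = Σ_l p l i · t^{d l}`. -/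
theorem letterPoly_eval (d : Fin K → ℕ) (p : Fin K → Fin m → ℝ) (i : Fin m) (t : ℝ) :
    (letterPoly d p i).eval t = ∑ l, p l i * t ^ d l := by
  simp [letterPoly, eval_finsetSum]

/-- Evaluation of a tilt: `r i (t) = Σ_l (d l − e) · p l i · t^{d l}`. -/
theorem tiltPoly_eval (d : Fin K → ℕ) (e : ℕ) (p : Fin K → Fin m → ℝ) (i : Fin m) (t : ℝ) :
    (tiltPoly d e p i).eval t = ∑ l, ((d l : ℝ) - e) * p l i * t ^ d l := by
  simp [tiltPoly, eval_finsetSum]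

/-- Positive letters are positive on `(0,∞)`. -/
theorem letterPoly_eval_pos (d : Fin K → ℕ) (p : Fin K → Fin m → ℝ) (hK : 0 < K)
    (hp : ∀ l i, 0 < p l i) (i : Fin m) {t : ℝ} (ht : 0 < t) : 0 < (letterPoly d p i).eval t := by
  rw [letterPoly_eval]
  haveI : Nonempty (Fin K) := ⟨⟨0, hK⟩⟩
  exact Finset.sum_pos (fun l _ => mul_pos (hp l i) (pow_pos ht _)) Finset.univ_nonempty

/-- The co-product weight `Π_{j ≠ i} q j(t)²` is positive on `(0,∞)`. -/
theorem coprodSq_eval_pos (d : Fin K → ℕ) (p : Fin K → Fin m → ℝ) (hK : 0 < K)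
    (hp : ∀ l i, 0 < p l i) (i : Fin m) {t : ℝ} (ht : 0 < t) :
    0 < (∏ j ∈ Finset.univ.erase i, letterPoly d p j ^ 2).eval t := by
  rw [eval_prod]
  exact Finset.prod_pos fun j _ => by
    rw [eval_pow]; exact pow_pos (letterPoly_eval_pos d p hK hp j ht) 2

/-! #### The TILT PENCIL and the e-free INFLECTION LAW (v2.0, memo §15)

For fixed letters the critical polynomial is an AFFINE PENCIL in the tilt: `S_e = S_0 − e·A`, `A = Σ_i q_i·Π_{j≠i} q_j² = (Π_i q_i)·(Σ_i Π_{j≠i} q_j)`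
positive on `(0,∞)` (`critPoly_pencil`, `pencilDir_eval_pos`).  ROLLE FOR THE PENCIL (`posRoots_pencil_le_succ`, kernel): the distinct positive roots
of `S_e` number at most ONE MORE than those of the e-FREE Wronskian `W = S_0'·A − S_0·A'` (`inflWronskian`) — for EVERY tilt `e` at once.  Reading:
`S_0/A = θ log (Σ_i 1/q_i)⁻¹… ` precisely `S_0/A = −θ log G`, `G = Σ_i 1/q_i`, `θ = X·d/dX`, so `X·W = −A²·θθ log G`: the positive roots of `W` are
exactly the INFLECTION POINTS of `H(x) = log Σ_i 1/q_i(e^x) = −softmin_i log q_i(e^x)`; by the softmin curvature identity (memo Thm B,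
`H'' = E_ω[Var_{μ_i} γ] − Var_ω(E_{μ_i} γ)`) they are the points where the WITHIN-letter variance of the slope equals its BETWEEN-letter variance under
the two-level Gibbs measure.  The located law `InflectionBudget m K`: `W` has at most `2(m−1)(K−1)` distinct positive roots — «the softmin of `m`
log-K-nomials with common exponents has at most `2(m−1)(K−1)` inflection points».  It is e-FREE and PEAK-FREE (no windows, no chains), implies
CKB(m,K) — hence COMM-L1(m,K) — for every tilt simultaneously (`commCriticalBudget_of_inflectionBudget`, unconditional), and is ATTAINED: exact
census (instr/g10/einf.py, einf_kink.py, e6roots.py; exact rational arithmetic + Vincent–Collins–Akritas isolation) ≈ 2 500 designs at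
(2,3),(2,4),(2,5),(3,3),(3,4),(4,3): 0 violations, budget attained at (2,3),(2,4),(2,5),(3,3); plain Descartes on `W` is blind (up to 30 sign changes at
(3,3) against budget 8).  Reproduced independently by val-idea-crit-2 #46 (≈ 17 500 evaluations, 76 VCA-certified designs in 24 cell/pattern
combinations, 0 violations, budget attained with certified counts (2,2) = 2, (2,3) = 4 on six patterns, (3,2) = 4, (2,4) = 6, (3,3) = 8) and by
val-idea-crit-1 #99/#103.  STATUS (v2.2, gen 11): a THEOREM at `K = 2` for every `m` (`inflectionBudget_K_two`, below — pole counting after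
`u = X^{d₁−d₀}`); LOCATED (no proof claimed) at `K ≥ 3`, where the margin is ZERO in every measured cell.  REACH, stated honestly (crit-2 #46 P3):
CKB/COMM at `m ≤ 2` and at `K = 2` are known by degree, so IB's NEW content toward stmt-18050 is `m ≥ 3`, `K ≥ 3`; the located statement of record is
**IB(3,3): the inflection Wronskian of three positive trinomials on common exponents has at most 8 distinct positive roots** — whence CKB(3,3) «≤ 9»
and COMM(3,3) «≤ 10» by the kernel edges — with tight 8-root designs on (0,19,22) and (0,1,3) deposited by this seat (instr/g10) and by crit-2
(`evidence/g4/ib_runs.txt`) as witnesses of weakness.  FIRST EXACT TARGET (crit-2 #46 P1): IB(2,3) at `d = (0,1,2)` — «`sumLetterExcess` of two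
positive quadratics has at most 4 positive roots» (degree 10 after the factor `X`, four effective parameters) — the Dip Lemma of the line in its
smallest cell; OPEN. -/

/-- The pencil direction `A = Σ_i q_i · Π_{j≠i} q_j²` (`S_e = S_0 − e·A`). -/
noncomputable def pencilDir (d : Fin K → ℕ) (p : Fin K → Fin m → ℝ) : ℝ[X] :=
  ∑ i, letterPoly d p i * ∏ j ∈ Finset.univ.erase i, letterPoly d p j ^ 2

theorem tiltPoly_pencil (d : Fin K → ℕ) (e : ℕ) (p : Fin K → Fin m → ℝ) (i : Fin m) :
    tiltPoly d e p i = tiltPoly d 0 p i - C (e : ℝ) * letterPoly d p i := by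
  unfold tiltPoly letterPoly
  rw [Finset.mul_sum, ← Finset.sum_sub_distrib]
  refine Finset.sum_congr rfl fun l _ => ?_
  simp only [Nat.cast_zero, sub_zero, map_mul, map_sub]
  ring

/-- **The tilt pencil (kernel):** `S_e = S_0 − e·A`. -/
theorem critPoly_pencil (d : Fin K → ℕ) (e : ℕ) (p : Fin K → Fin m → ℝ) :
    critPoly d e p = critPoly d 0 p - C (e : ℝ) * pencilDir d p := by
  unfold critPoly pencilDir
  rw [Finset.mul_sum, ← Finset.sum_sub_distrib]
  refine Finset.sum_congr rfl fun i _ => ?_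
  rw [tiltPoly_pencil d e p i]
  ring

theorem pencilDir_eval_pos (d : Fin K → ℕ) (p : Fin K → Fin m → ℝ) (hK : 0 < K) (hm : 0 < m)
    (hp : ∀ l i, 0 < p l i) {t : ℝ} (ht : 0 < t) : 0 < (pencilDir d p).eval t := by
  unfold pencilDir
  rw [eval_finsetSum]
  haveI : Nonempty (Fin m) := ⟨⟨0, hm⟩⟩
  exact Finset.sum_pos (fun i _ => by
    rw [eval_mul]; exact mul_pos (letterPoly_eval_pos d p hK hp i ht) (coprodSq_eval_pos d p hK hp i ht))
    Finset.univ_nonempty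

/-- The e-free INFLECTION WRONSKIAN `W = S_0'·A − S_0·A'` (positive roots = inflection points of `log Σ_i 1/q_i(e^x)`). -/
noncomputable def inflWronskian (d : Fin K → ℕ) (p : Fin K → Fin m → ℝ) : ℝ[X] :=
  derivative (critPoly d 0 p) * pencilDir d p - critPoly d 0 p * derivative (pencilDir d p)

/-- **Rolle for an affine pencil (kernel).**  If `A` does not vanish on `(0,∞)`, then for every level `e` the distinct positive roots of `S − e·A`
number at most one more than those of the Wronskian `S'·A − S·A'`: between two consecutive roots `S/A` takes the value `e` twice. -/
theorem posRoots_pencil_le_succ (S A : ℝ[X]) (e : ℝ) (hA : ∀ t : ℝ, 0 < t → A.eval t ≠ 0) :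
    posRoots (S - C e * A) ≤ posRoots (derivative S * A - S * derivative A) + 1 := by
  classical
  -- the quotient `f = S/A` on `(0,∞)` and its derivative
  have hder : ∀ t : ℝ, 0 < t → HasDerivAt (fun x => S.eval x / A.eval x)
      (((derivative S).eval t * A.eval t - S.eval t * (derivative A).eval t) / A.eval t ^ 2) t :=
    fun t ht => (S.hasDerivAt t).div (A.hasDerivAt t) (hA t ht)
  have hcont : ∀ x y : ℝ, 0 < x → ContinuousOn (fun x => S.eval x / A.eval x) (Set.Icc x y) :=
    fun x y hx => (S.continuous.continuousOn).div A.continuous.continuousOn fun t ht => hA t (hx.trans_le ht.1)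
  have hval : ∀ t : ℝ, 0 < t → (S - C e * A).IsRoot t → S.eval t / A.eval t = e := by
    intro t ht hr
    have h0 : S.eval t - e * A.eval t = 0 := by simpa [eval_sub, eval_mul, eval_C] using hr
    rw [div_eq_iff (hA t ht)]
    linarith
  have hWev : ∀ t : ℝ, (derivative S * A - S * derivative A).eval t =
      (derivative S).eval t * A.eval t - S.eval t * (derivative A).eval t := by
    intro t; simp [eval_sub, eval_mul]
  by_cases hSe : S - C e * A = 0
  · simp [posRoots, hSe]
  by_cases hW : derivative S * A - S * derivative A = 0
  · -- `f` is constant on `(0,∞)`; a positive root would make `S − e·A` vanish on `(0,∞)`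
    have hnone : ((S - C e * A).roots.toFinset.filter (fun t => 0 < t)) = ∅ := by
      rw [Finset.eq_empty_iff_forall_notMem]
      intro x hx
      rw [Finset.mem_filter, Multiset.mem_toFinset, mem_roots hSe] at hx
      obtain ⟨hxr, hxpos⟩ := hx
      apply hSe
      apply eq_zero_of_infinite_isRoot
      apply Set.Infinite.mono _ (Set.Ioi_infinite (0 : ℝ))
      intro t ht
      have htpos : 0 < t := ht
      show (S - C e * A).IsRoot t
      have hft : S.eval t / A.eval t = e := by
        rcases lt_trichotomy x t with hlt | heq | hgt
        · obtain ⟨c, hc, hslope⟩ := exists_hasDerivAt_eq_slope (fun x => S.eval x / A.eval x) _ hlt (hcont x t hxpos)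
            (fun c hc => hder c (hxpos.trans hc.1))
          have hc0 : ((derivative S).eval c * A.eval c - S.eval c * (derivative A).eval c) / A.eval c ^ 2 = 0 := by
            rw [← hWev, hW, eval_zero, zero_div]
          rw [hc0, eq_comm, div_eq_zero_iff] at hslope
          rcases hslope with h | h
          · rw [sub_eq_zero] at h; rw [h, hval x hxpos hxr]
          · exact absurd (sub_eq_zero.mp h) (ne_of_gt hlt)
        · rw [← heq]; exact hval x hxpos hxr
        · obtain ⟨c, hc, hslope⟩ := exists_hasDerivAt_eq_slope (fun x => S.eval x / A.eval x) _ hgt (hcont t x htpos)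
            (fun c hc => hder c (htpos.trans hc.1))
          have hc0 : ((derivative S).eval c * A.eval c - S.eval c * (derivative A).eval c) / A.eval c ^ 2 = 0 := by
            rw [← hWev, hW, eval_zero, zero_div]
          rw [hc0, eq_comm, div_eq_zero_iff] at hslope
          rcases hslope with h | h
          · rw [sub_eq_zero] at h; rw [← h, hval x hxpos hxr]
          · exact absurd (sub_eq_zero.mp h) (ne_of_gt hgt)
      have : S.eval t = e * A.eval t := by rw [div_eq_iff (hA t htpos)] at hft; exact hft
      simp [IsRoot, eval_sub, eval_mul, eval_C, this]
    unfold posRoots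
    rw [hnone, Finset.card_empty]
    exact Nat.zero_le _
  · unfold posRoots
    refine Finset.card_le_of_interleaved fun x hx y hy hxy _ => ?_
    rw [Finset.mem_filter, Multiset.mem_toFinset, mem_roots hSe] at hx hy
    have hfx : (fun x => S.eval x / A.eval x) x = (fun x => S.eval x / A.eval x) y := by
      show S.eval x / A.eval x = S.eval y / A.eval y
      rw [hval x hx.2 hx.1, hval y hy.2 hy.1]
    obtain ⟨c, hc, hc0⟩ := exists_hasDerivAt_eq_zero hxy (hcont x y hx.2) hfx (fun c hc => hder c (hx.2.trans hc.1))
    have hcpos : 0 < c := hx.2.trans hc.1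
    refine ⟨c, ?_, hc.1, hc.2⟩
    rw [Finset.mem_filter, Multiset.mem_toFinset, mem_roots hW]
    refine ⟨?_, hcpos⟩
    show (derivative S * A - S * derivative A).IsRoot c
    rw [IsRoot, hWev]
    rw [div_eq_zero_iff] at hc0
    rcases hc0 with h | h
    · exact h
    · exact absurd ((pow_eq_zero_iff two_ne_zero).mp h) (hA c hcpos)

/-- **IB(m,K) — the e-free INFLECTION LAW** (memo `negsquares-kink.md` §15; LOCATED CONJECTURE, no proof claimed): for strictly increasing exponents and
positive letters the inflection Wronskian has at most `2(m−1)(K−1)` distinct positive roots, i.e. `log Σ_i 1/q_i(e^x)` (minus the softmin of the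
letters' log-profiles) has at most `2(m−1)(K−1)` inflection points.  e-free and peak-free; tropically: the lower envelope of `m` convex PL functions with
`K−1` kinks each alternates convex/concave corners at most `2(m−1)(K−1)` times — a HEURISTIC picture ONLY (crit-2 #46 P2, #47; memo §15.8(iv)):
the smooth count is NOT bounded by the tropical count design-by-design (38/40 exact designs exceed their own PL skeleton's count), merged smooth
transitions are exactly where the two window laws of this line died, and the located PL «Island Lemma» of memo §15.8 is a MODEL of IB(2,K), not an edge
to it (PL ⇏ IB; certifying it proves nothing toward stmt-18050).  Kernel edge: `commCriticalBudget_of_inflectionBudget`.  Cheapest kill: ONE positive design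
whose `inflWronskian` has more than `2(m−1)(K−1)` positive roots (exact censuses by three seats, 0 violations, budget attained — ZERO margin).
**STATUS (v2.2): THEOREM at `K = 2` for every `m` (`inflectionBudget_K_two`); located conjecture at `K ≥ 3`; statement of record IB(3,3) «≤ 8»;
first exact target IB(2,3) at d = (0,1,2).** [val-idea-6 g10 v2.0 located / g11 v2.2: theorem at K = 2] -/
def InflectionBudget (m K : ℕ) : Prop :=
  ∀ (d : Fin K → ℕ) (p : Fin K → Fin m → ℝ), StrictMono d → (∀ l i, 0 < p l i) →
    posRoots (inflWronskian d p) ≤ 2 * (m - 1) * (K - 1)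

/-- **IB(m,K) ⇒ CKB(m,K) for every tilt (kernel, unconditional).**  The tilt pencil `S_e = S_0 − e·A` with `A > 0` on `(0,∞)` and Rolle for the
pencil. -/
theorem commCriticalBudget_of_inflectionBudget (h : InflectionBudget m K) : CommCriticalBudget m K := by
  classical
  intro d e p hd hp
  rcases Nat.eq_zero_or_pos K with hK | hK
  · subst hK
    have : critPoly d e p = 0 := by simp [critPoly, tiltPoly]
    simp [posRoots, this]
  rcases Nat.eq_zero_or_pos m with hm | hm
  · subst hm
    have : critPoly d e p = 0 := by simp [critPoly]
    simp [posRoots, this]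
  have hA : ∀ t : ℝ, 0 < t → (pencilDir d p).eval t ≠ 0 := fun t ht => (pencilDir_eval_pos d p hK hm hp ht).ne'
  have h1 := posRoots_pencil_le_succ (critPoly d 0 p) (pencilDir d p) (e : ℝ) hA
  rw [← critPoly_pencil] at h1
  have h2 := h d p hd hp
  unfold inflWronskian at h2
  omega

/-- IB(m,K) alone carries COMM-L1(m,K) in kernel (`K ≥ 1`). -/
theorem commOneLawSharp_of_inflectionBudget (hK : 0 < K) (h : InflectionBudget m K) : CommOneLawSharp m K :=
  commOneLawSharp_of_commCriticalBudget hK (commCriticalBudget_of_inflectionBudget h)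


/-! #### The SUM-LETTER form of the inflection law at `m = 2` (v2.1, memo §15.7)

For two letters `H = log (1/q₀ + 1/q₁) = V₊ − V₀ − V₁`, where `V₊` is the log-profile of the SUM LETTER `q₀ + q₁` — again a positive
K-nomial on the same exponents — so `H'' = Var_{μ₊} − Var_{μ₀} − Var_{μ₁}` (variance of the slope under the Gibbs measures of `q₀ + q₁`, `q₀`, `q₁`).
In kernel (`X_mul_inflWronskian_two`): `X · inflWronskian = −(D(q₀+q₁)·q₀²·q₁² − D q₀·(q₀+q₁)²·q₁² − D q₁·(q₀+q₁)²·q₀²)` with the θ-Laguerre form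
`D f = f·θθf − (θf)²` (`lagVar`; `θθ log f = D f / f²`), hence `posRoots_inflWronskian_two` and `inflectionBudget_two_iff`: **IB(2,K) ⇔ the variance
profile of the sum of two positive K-nomials (common exponents) exceeds the sum of their variance profiles on at most `K − 1` intervals of `(0,∞)`**
(`2K − 2` crossings).  Companion located observation (memo §15.7; instr/g10/varmodes.py, k3poly.py): the variance profile of ONE positive K-nomial is at
most `(K−1)`-modal (1 500 designs, attained), and for `K ≤ 4` plain Descartes on the third-cumulant numerator `f²θ³f − 3fθfθ²f + 2(θf)³` certifies it
(coefficient signs forced by the exponent order; prover-sized via `Polynomial.roots_countP_pos_le_signVariations`). -/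

/-- `θ f = X · f'` (Euler operator). -/
noncomputable def thetaOp (f : ℝ[X]) : ℝ[X] := X * derivative f

/-- The θ-Laguerre form `D f = f · θθf − (θf)²` — the numerator of `θθ log f`, i.e. of the variance of the exponent under the Gibbs measure of `f`. -/
noncomputable def lagVar (f : ℝ[X]) : ℝ[X] := f * thetaOp (thetaOp f) - thetaOp f ^ 2

/-- The SUM-LETTER EXCESS `D(q₀+q₁)·q₀²q₁² − D q₀·(q₀+q₁)²q₁² − D q₁·(q₀+q₁)²q₀²` = `(q₀ q₁ (q₀+q₁))² · θθ log (1/q₀ + 1/q₁)`. -/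
noncomputable def sumLetterExcess (q₀ q₁ : ℝ[X]) : ℝ[X] :=
  lagVar (q₀ + q₁) * q₀ ^ 2 * q₁ ^ 2 - lagVar q₀ * (q₀ + q₁) ^ 2 * q₁ ^ 2 - lagVar q₁ * (q₀ + q₁) ^ 2 * q₀ ^ 2

/-- The two-letter pencil Wronskian is minus the sum-letter excess divided by `X` (pure polynomial algebra). -/
theorem wronskian_two_eq_neg_sumLetterExcess (q₀ q₁ : ℝ[X]) :
    X * (derivative (thetaOp q₀ * q₁ ^ 2 + thetaOp q₁ * q₀ ^ 2) * (q₀ * q₁ ^ 2 + q₁ * q₀ ^ 2)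
      - (thetaOp q₀ * q₁ ^ 2 + thetaOp q₁ * q₀ ^ 2) * derivative (q₀ * q₁ ^ 2 + q₁ * q₀ ^ 2))
    = -sumLetterExcess q₀ q₁ := by
  simp only [sumLetterExcess, lagVar, thetaOp, derivative_mul, derivative_add, derivative_X, pow_two]
  ring

private theorem univ_erase_zero_fin_two : (Finset.univ : Finset (Fin 2)).erase 0 = {1} := by decide
private theorem univ_erase_one_fin_two : (Finset.univ : Finset (Fin 2)).erase 1 = {0} := by decide

/-- Two letters, no tilt: `S_0 = θq₀ · q₁² + θq₁ · q₀²`. -/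
theorem critPoly_zero_two (d : Fin K → ℕ) (p : Fin K → Fin 2 → ℝ) :
    critPoly d 0 p = thetaOp (letterPoly d p 0) * letterPoly d p 1 ^ 2 + thetaOp (letterPoly d p 1) * letterPoly d p 0 ^ 2 := by
  unfold critPoly
  rw [Fin.sum_univ_two, univ_erase_zero_fin_two, univ_erase_one_fin_two, Finset.prod_singleton, Finset.prod_singleton,
    tiltPoly_eq, tiltPoly_eq]
  simp [thetaOp]

/-- Two letters: `A = q₀ · q₁² + q₁ · q₀²`. -/
theorem pencilDir_two (d : Fin K → ℕ) (p : Fin K → Fin 2 → ℝ) :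
    pencilDir d p = letterPoly d p 0 * letterPoly d p 1 ^ 2 + letterPoly d p 1 * letterPoly d p 0 ^ 2 := by
  unfold pencilDir
  rw [Fin.sum_univ_two, univ_erase_zero_fin_two, univ_erase_one_fin_two, Finset.prod_singleton, Finset.prod_singleton]

/-- **Kernel dictionary at `m = 2`:** `X · inflWronskian = −sumLetterExcess q₀ q₁`. -/
theorem X_mul_inflWronskian_two (d : Fin K → ℕ) (p : Fin K → Fin 2 → ℝ) :
    X * inflWronskian d p = -sumLetterExcess (letterPoly d p 0) (letterPoly d p 1) := by
  unfold inflWronskian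
  rw [critPoly_zero_two, pencilDir_two]
  exact wronskian_two_eq_neg_sumLetterExcess _ _

/-- Multiplying by `X` does not change the distinct positive roots. -/
theorem posRoots_X_mul (f : ℝ[X]) : posRoots (X * f) = posRoots f := by
  unfold posRoots
  by_cases hf : f = 0
  · simp [hf]
  · rw [Polynomial.roots_mul (mul_ne_zero X_ne_zero hf), roots_X, Multiset.toFinset_add, Multiset.toFinset_singleton,
      Finset.filter_union, Finset.filter_singleton, if_neg (lt_irrefl (0 : ℝ)), Finset.empty_union]

/-- Negation does not change the distinct positive roots. -/
theorem posRoots_neg' (f : ℝ[X]) : posRoots (-f) = posRoots f := by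
  unfold posRoots
  rw [Polynomial.roots_neg]

/-- The distinct positive roots of the two-letter pencil Wronskian are those of the sum-letter excess. -/
theorem posRoots_inflWronskian_two (d : Fin K → ℕ) (p : Fin K → Fin 2 → ℝ) :
    posRoots (inflWronskian d p) = posRoots (sumLetterExcess (letterPoly d p 0) (letterPoly d p 1)) := by
  rw [← posRoots_X_mul (inflWronskian d p), X_mul_inflWronskian_two, posRoots_neg']

/-- **IB(2,K) in sum-letter form:** the variance profile of `q₀ + q₁` exceeds `Var q₀ + Var q₁` at most `2K − 2` times (crossings) on `(0,∞)`. -/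
theorem inflectionBudget_two_iff :
    InflectionBudget 2 K ↔ ∀ (d : Fin K → ℕ) (p : Fin K → Fin 2 → ℝ), StrictMono d → (∀ l i, 0 < p l i) →
      posRoots (sumLetterExcess (letterPoly d p 0) (letterPoly d p 1)) ≤ 2 * (K - 1) := by
  have h2 : 2 * (2 - 1) * (K - 1) = 2 * (K - 1) := by norm_num
  unfold InflectionBudget
  simp only [posRoots_inflWronskian_two, h2]

/-! ### v2.2 (gen 11) — the sum-letter form for EVERY `m` (val-idea-crit-2 #47 P3)

With `Π := ∏ⱼ qⱼ` and `P := Σᵢ ∏_{j≠i} qⱼ = e_{m−1}(q)` (so `G = Σᵢ 1/qᵢ = P/Π`):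
`A = pencilDir = Π·P`, `S₀ = critPoly d 0 p = P·θΠ − Π·θP`, hence `X·W = P²·lagVar Π − Π²·lagVar P`
(`W = inflWronskian`).  Since `lagVar (f·g) = lagVar f · g² + f² · lagVar g` («`θθ log` is additive»),
`lagVar Π = Σⱼ lagVar qⱼ · ∏_{i≠j} qᵢ²`, which is the boxed SUM-LETTER form
`X·W = −(lagVar P · Π² − P² · Σⱼ lagVar qⱼ · ∏_{i≠j} qᵢ²) = −E(q)`; at `m = 2`, `E = sumLetterExcess q₀ q₁` (v2.1).
`inflectionBudget_iff_sumLetter` types IB(m,K) for all `m` as «`Z₊(E(q)) ≤ 2(m−1)(K−1)`». -/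

theorem thetaOp_mul (f g : ℝ[X]) : thetaOp (f * g) = thetaOp f * g + f * thetaOp g := by
  simp only [thetaOp, derivative_mul]; ring

theorem thetaOp_add (f g : ℝ[X]) : thetaOp (f + g) = thetaOp f + thetaOp g := by
  simp only [thetaOp, derivative_add]; ring

theorem thetaOp_sub (f g : ℝ[X]) : thetaOp (f - g) = thetaOp f - thetaOp g := by
  simp only [thetaOp, derivative_sub]; ring

theorem thetaOp_sum {ι : Type*} (s : Finset ι) (f : ι → ℝ[X]) :
    thetaOp (∑ i ∈ s, f i) = ∑ i ∈ s, thetaOp (f i) := by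
  simp only [thetaOp, derivative_sum, Finset.mul_sum]

/-- `lagVar` is a «derivation-square»: `lagVar (f·g) = lagVar f · g² + f² · lagVar g` (i.e. `θθ log` is additive). -/
theorem lagVar_mul (f g : ℝ[X]) : lagVar (f * g) = lagVar f * g ^ 2 + f ^ 2 * lagVar g := by
  simp only [lagVar, thetaOp, derivative_mul, derivative_add, derivative_X]; ring

@[simp] theorem lagVar_one : lagVar (1 : ℝ[X]) = 0 := by simp [lagVar, thetaOp]

@[simp] theorem lagVar_C (c : ℝ) : lagVar (C c) = 0 := by simp [lagVar, thetaOp]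

theorem lagVar_C_mul (c : ℝ) (f : ℝ[X]) : lagVar (C c * f) = C c ^ 2 * lagVar f := by
  rw [lagVar_mul, lagVar_C]; ring

/-- `lagVar (∏ qⱼ) = Σⱼ lagVar qⱼ · ∏_{i≠j} qᵢ²`. -/
theorem lagVar_prod {ι : Type*} [DecidableEq ι] (s : Finset ι) (q : ι → ℝ[X]) :
    lagVar (∏ i ∈ s, q i) = ∑ i ∈ s, lagVar (q i) * ∏ j ∈ s.erase i, q j ^ 2 := by
  induction s using Finset.induction_on with
  | empty => simp
  | @insert a s ha ih =>
    rw [Finset.prod_insert ha, lagVar_mul, ih, Finset.sum_insert ha, Finset.erase_insert ha,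
      Finset.mul_sum, Finset.prod_pow]
    congr 1
    refine Finset.sum_congr rfl fun i hi => ?_
    have hai : a ≠ i := fun h => ha (h ▸ hi)
    rw [Finset.erase_insert_of_ne hai, Finset.prod_insert (fun h => ha (Finset.mem_of_mem_erase h))]
    ring

/-- `e_{m-1}` of the letters: `P(q) = Σᵢ ∏_{j≠i} qⱼ`, the numerator of `G = Σᵢ 1/qᵢ = P/Π`. -/
noncomputable def coprodSum (q : Fin m → ℝ[X]) : ℝ[X] := ∑ i, ∏ j ∈ univ.erase i, q j

/-- The general SUM-LETTER EXCESS `E(q) := lagVar P · (∏ qⱼ)² − P² · Σⱼ lagVar qⱼ · ∏_{i≠j} qᵢ²`. -/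
noncomputable def sumLetterExcessGen (q : Fin m → ℝ[X]) : ℝ[X] :=
  lagVar (coprodSum q) * (∏ j, q j) ^ 2 - coprodSum q ^ 2 * ∑ j, lagVar (q j) * ∏ i ∈ univ.erase j, q i ^ 2

/-- `A = Π · P`. -/
theorem pencilDir_eq_prod_mul_coprodSum (d : Fin K → ℕ) (p : Fin K → Fin m → ℝ) :
    pencilDir d p = (∏ j, letterPoly d p j) * coprodSum (letterPoly d p) := by
  unfold pencilDir coprodSum
  rw [Finset.mul_sum]
  refine Finset.sum_congr rfl fun i _ => ?_
  rw [← Finset.mul_prod_erase univ (letterPoly d p) (mem_univ i), Finset.prod_pow]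
  ring

/-- `S₀ = P·θΠ − Π·θP`. -/
theorem critPoly_zero_eq (d : Fin K → ℕ) (p : Fin K → Fin m → ℝ) :
    critPoly d 0 p = coprodSum (letterPoly d p) * thetaOp (∏ j, letterPoly d p j)
      - (∏ j, letterPoly d p j) * thetaOp (coprodSum (letterPoly d p)) := by
  set q := letterPoly d p with hq
  have h1 : critPoly d 0 p = ∑ i, thetaOp (q i) * (∏ j ∈ univ.erase i, q j) ^ 2 := by
    unfold critPoly
    refine Finset.sum_congr rfl fun i _ => ?_
    rw [tiltPoly_eq, Finset.prod_pow]
    simp [thetaOp, hq]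
  rw [h1, coprodSum, thetaOp_sum, Finset.sum_mul, Finset.mul_sum, ← Finset.sum_sub_distrib]
  refine Finset.sum_congr rfl fun i _ => ?_
  have hPi : ∏ j, q j = q i * ∏ j ∈ univ.erase i, q j := (Finset.mul_prod_erase univ q (mem_univ i)).symm
  rw [hPi, thetaOp_mul]
  ring

theorem X_mul_wr (f g : ℝ[X]) :
    X * (derivative f * g - f * derivative g) = thetaOp f * g - f * thetaOp g := by
  simp only [thetaOp]; ring

/-- **The e-free Wronskian in product form (every `m`):** `X·W = P²·lagVar Π − Π²·lagVar P`. -/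
theorem X_mul_inflWronskian_eq (d : Fin K → ℕ) (p : Fin K → Fin m → ℝ) :
    X * inflWronskian d p = coprodSum (letterPoly d p) ^ 2 * lagVar (∏ j, letterPoly d p j)
      - (∏ j, letterPoly d p j) ^ 2 * lagVar (coprodSum (letterPoly d p)) := by
  rw [inflWronskian, X_mul_wr, critPoly_zero_eq, pencilDir_eq_prod_mul_coprodSum]
  simp only [lagVar, thetaOp_sub, thetaOp_mul]
  ring

/-- **Sum-letter form (every `m`):** `X·W = −E(q)`. -/
theorem X_mul_inflWronskian_gen (d : Fin K → ℕ) (p : Fin K → Fin m → ℝ) :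
    X * inflWronskian d p = -sumLetterExcessGen (letterPoly d p) := by
  rw [X_mul_inflWronskian_eq, sumLetterExcessGen, lagVar_prod]
  ring

theorem posRoots_inflWronskian_gen (d : Fin K → ℕ) (p : Fin K → Fin m → ℝ) :
    posRoots (inflWronskian d p) = posRoots (sumLetterExcessGen (letterPoly d p)) := by
  rw [← posRoots_X_mul (inflWronskian d p), X_mul_inflWronskian_gen, posRoots_neg']

/-- **IB(m,K) in sum-letter form, every `m`.** -/
theorem inflectionBudget_iff_sumLetter :
    InflectionBudget m K ↔ ∀ (d : Fin K → ℕ) (p : Fin K → Fin m → ℝ), StrictMono d → (∀ l i, 0 < p l i) →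
      posRoots (sumLetterExcessGen (letterPoly d p)) ≤ 2 * (m - 1) * (K - 1) := by
  unfold InflectionBudget
  simp only [posRoots_inflWronskian_gen]

/-- Consistency with the two-letter form of v2.1. -/
theorem sumLetterExcessGen_two (q : Fin 2 → ℝ[X]) : sumLetterExcessGen q = sumLetterExcess (q 0) (q 1) := by
  simp only [sumLetterExcessGen, coprodSum, sumLetterExcess, Fin.sum_univ_two, Fin.prod_univ_two,
    univ_erase_zero_fin_two, univ_erase_one_fin_two, Finset.prod_singleton]
  ring


/-! ### v2.2 (gen 11) — **THEOREM IB(m,2)** for every `m` by POLE COUNTING (memo `negsquares-kink.md` §16)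

For `K = 2` substitute `u = X^{d₁−d₀}`: the letters become LINEAR, `qᵢ ↦ bᵢ(u + αᵢ)`, `αᵢ = p₀ᵢ/p₁ᵢ > 0`, and
`G = Σ 1/qᵢ` becomes the Stieltjes function `G̃(u) = Σ_c w_c/(u + α_c)` (distinct poles `α_c`, positive weights —
coincident ratios merge into one pole, the common factor leaving as `M⁴` by `EE_mul_left`).  The excess
`Ê = lagVar P̂ · Π̂² − P̂² · lagVar Π̂` (`Π̂ = ∏ (u+α_c)`, `P̂ = Σ w_c ∏_{c'≠c} (u+α_{c'})`) has degree `≤ 4s+1`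
(`s+1` poles; the top coefficients of `lagVar` cancel), vanishes at `u = 0`, is `> 0` at every pole `−α_c`
(`Ê(−α_c) = P̂(−α_c)²·α_c²·Π̂′(−α_c)²`) and `< 0` at the zero `−ζ_k` of `P̂` inside each of the `s` gaps
(`Ê(−ζ) = −ζ²P̂′(−ζ)²Π̂(−ζ)²`, and `P̂′(−ζ) = Π̂(−ζ)·G̃′(−ζ) ≠ 0` because `G̃′ < 0`): `2s` sign changes on `(−∞,0)`,
so at most `4s+1 − 2s − 1 = 2s = 2(m−1)(K−1)` distinct POSITIVE roots.  Kernel: `posRoots_EE_poleSum_le` (sorted poles),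
`posRoots_EE_finset_le` (any finite pole set), `posRoots_EE_linear` (letters, coincidences allowed),
`inflectionBudget_K_two : InflectionBudget m 2`, whence `CommCriticalBudget m 2` and `CommOneLawSharp m 2` for every `m`
by the v2.0 kernel edges.  (These K = 2 cells were known for CKB/COMM by degree; the point is that the LOCATED LAW IB itself
is now a theorem in its first infinite family, by an argument — real-rootedness of the `u`-letters — that is NOT available
at `K ≥ 3`, where the letters `Σ_l p_l X^{d_l}` have complex roots: the (2,3) cell is the Dip Lemma, still open.) -/

/-- `EE P Q := lagVar P · Q² − P² · lagVar Q`; `E(q) = EE (coprodSum q) (∏ q)` by `lagVar_prod`. -/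
noncomputable def EE (P Q : ℝ[X]) : ℝ[X] := lagVar P * Q ^ 2 - P ^ 2 * lagVar Q

/-- Gauge invariance: a common factor comes out as `M⁴` (the `lagVar M` terms cancel). -/
theorem EE_mul_left (M P Q : ℝ[X]) : EE (M * P) (M * Q) = M ^ 4 * EE P Q := by
  simp only [EE, lagVar_mul]; ring

theorem eval_thetaOp (f : ℝ[X]) (u : ℝ) : (thetaOp f).eval u = u * (derivative f).eval u := by
  simp [thetaOp]

theorem eval_lagVar (f : ℝ[X]) (u : ℝ) :
    (lagVar f).eval u = f.eval u * (thetaOp (thetaOp f)).eval u - (u * (derivative f).eval u) ^ 2 := by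
  simp [lagVar, eval_thetaOp]

theorem eval_EE (P Q : ℝ[X]) (u : ℝ) : (EE P Q).eval u =
    (lagVar P).eval u * (Q.eval u) ^ 2 - (P.eval u) ^ 2 * (lagVar Q).eval u := by
  simp [EE]

/-- `EE P Q` vanishes at `0` (both `lagVar`s do). -/
theorem EE_eval_zero (P Q : ℝ[X]) : (EE P Q).eval 0 = 0 := by
  simp [eval_EE, eval_lagVar, eval_thetaOp]

/-- At a zero `u ≠ 0` of `Q` where `P(u) ≠ 0 ≠ Q'(u)`: `EE P Q (u) > 0`. -/
theorem EE_eval_pos_of_root_right (P Q : ℝ[X]) {u : ℝ} (hu : u ≠ 0) (hQ : Q.eval u = 0)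
    (hP : P.eval u ≠ 0) (hQ' : (derivative Q).eval u ≠ 0) : 0 < (EE P Q).eval u := by
  have h2 : u * (derivative Q).eval u ≠ 0 := mul_ne_zero hu hQ'
  rw [eval_EE, eval_lagVar Q, hQ]
  have : (lagVar P).eval u * (0 : ℝ) ^ 2 - (P.eval u) ^ 2 * (0 * (thetaOp (thetaOp Q)).eval u
      - (u * (derivative Q).eval u) ^ 2) = (P.eval u) ^ 2 * (u * (derivative Q).eval u) ^ 2 := by ring
  rw [this]
  positivity

/-- At a zero `u ≠ 0` of `P` where `Q(u) ≠ 0 ≠ P'(u)`: `EE P Q (u) < 0`. -/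
theorem EE_eval_neg_of_root_left (P Q : ℝ[X]) {u : ℝ} (hu : u ≠ 0) (hP : P.eval u = 0)
    (hQ : Q.eval u ≠ 0) (hP' : (derivative P).eval u ≠ 0) : (EE P Q).eval u < 0 := by
  have h2 : u * (derivative P).eval u ≠ 0 := mul_ne_zero hu hP'
  rw [eval_EE, eval_lagVar P, hP]
  have : (0 * (thetaOp (thetaOp P)).eval u - (u * (derivative P).eval u) ^ 2) * (Q.eval u) ^ 2
      - (0 : ℝ) ^ 2 * (lagVar Q).eval u = -((u * (derivative P).eval u) ^ 2 * (Q.eval u) ^ 2) := by ring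
  rw [this, neg_lt_zero]
  positivity

/-! #### degree bookkeeping -/

theorem coeff_thetaOp (f : ℝ[X]) (k : ℕ) : (thetaOp f).coeff k = (k : ℝ) * f.coeff k := by
  rcases k with _ | k
  · simp [thetaOp, mul_coeff_zero]
  · rw [thetaOp, coeff_X_mul, coeff_derivative]; push_cast; ring

theorem natDegree_thetaOp_le (f : ℝ[X]) : (thetaOp f).natDegree ≤ f.natDegree := by
  refine Polynomial.natDegree_le_iff_coeff_eq_zero.mpr fun k hk => ?_
  rw [coeff_thetaOp, Polynomial.coeff_eq_zero_of_natDegree_lt hk, mul_zero]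

/-- The top coefficients cancel: `deg (lagVar f) ≤ 2·deg f − 1`. -/
theorem natDegree_lagVar_le (f : ℝ[X]) : (lagVar f).natDegree ≤ 2 * f.natDegree - 1 := by
  set N := f.natDegree with hN
  have h1 : (thetaOp (thetaOp f)).natDegree ≤ N := (natDegree_thetaOp_le _).trans (natDegree_thetaOp_le f)
  have h2 : (thetaOp f).natDegree ≤ N := natDegree_thetaOp_le f
  have hle : (lagVar f).natDegree ≤ 2 * N := by
    unfold lagVar
    refine (natDegree_sub_le _ _).trans (max_le ?_ ?_)
    · exact (natDegree_mul_le).trans (by omega)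
    · exact (natDegree_pow_le).trans (by omega)
  have hc : (lagVar f).coeff (2 * N) = 0 := by
    rw [lagVar, coeff_sub, two_mul, pow_two, coeff_mul_add_eq_of_natDegree_le (le_refl N) h1,
      coeff_mul_add_eq_of_natDegree_le h2 h2]
    simp only [coeff_thetaOp]
    ring
  exact natDegree_le_pred hle hc

theorem natDegree_EE_le (P Q : ℝ[X]) (s : ℕ) (hP : P.natDegree ≤ s) (hQ : Q.natDegree ≤ s + 1) :
    (EE P Q).natDegree ≤ 4 * s + 1 := by
  unfold EE
  refine (natDegree_sub_le _ _).trans (max_le ?_ ?_)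
  · rcases Nat.eq_zero_or_pos P.natDegree with h0 | hpos
    · rw [Polynomial.eq_C_of_natDegree_eq_zero h0, lagVar_C, zero_mul, natDegree_zero]; omega
    · have := natDegree_lagVar_le P
      refine natDegree_mul_le.trans ?_
      have hq2 : (Q ^ 2).natDegree ≤ 2 * (s + 1) := natDegree_pow_le.trans (by omega)
      omega
  · have := natDegree_lagVar_le Q
    refine natDegree_mul_le.trans ?_
    have hp2 : (P ^ 2).natDegree ≤ 2 * s := natDegree_pow_le.trans (by omega)
    omega

/-! #### the pole / partial-fraction data -/

section Poles
variable {s : ℕ}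

/-- `Π̂ = ∏_c (X + α_c)`. -/
noncomputable def poleProd (α : Fin (s+1) → ℝ) : ℝ[X] := ∏ c, (X + C (α c))
/-- `P̂ = Σ_c w_c ∏_{c'≠c} (X + α_{c'})`, so that `P̂/Π̂ = Σ_c w_c/(X + α_c)`. -/
noncomputable def poleSum (α w : Fin (s+1) → ℝ) : ℝ[X] := ∑ c, C (w c) * ∏ c' ∈ univ.erase c, (X + C (α c'))

theorem eval_poleProd (α : Fin (s+1) → ℝ) (u : ℝ) : (poleProd α).eval u = ∏ c, (u + α c) := by
  simp [poleProd, eval_prod]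

theorem eval_poleSum (α w : Fin (s+1) → ℝ) (u : ℝ) :
    (poleSum α w).eval u = ∑ c, w c * ∏ c' ∈ univ.erase c, (u + α c') := by
  simp [poleSum, eval_finsetSum, eval_prod]

theorem natDegree_poleProd_le (α : Fin (s+1) → ℝ) : (poleProd α).natDegree ≤ s + 1 := by
  unfold poleProd
  refine (natDegree_prod_le _ _).trans ?_
  simp

theorem natDegree_poleSum_le (α w : Fin (s+1) → ℝ) : (poleSum α w).natDegree ≤ s := by
  unfold poleSum
  refine natDegree_sum_le_of_forall_le _ _ fun c _ => (natDegree_C_mul_le _ _).trans ?_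
  refine (natDegree_prod_le _ _).trans ?_
  simp [Finset.card_erase_of_mem]

theorem poleSum_eval_neg (α w : Fin (s+1) → ℝ) (c : Fin (s+1)) :
    (poleSum α w).eval (-α c) = w c * ∏ c' ∈ univ.erase c, (α c' - α c) := by
  rw [eval_poleSum, Finset.sum_eq_single c]
  · congr 1
    exact Finset.prod_congr rfl fun c' _ => by ring
  · intro b _ hb
    rw [Finset.prod_eq_zero (Finset.mem_erase.mpr ⟨fun h => hb h.symm, mem_univ c⟩) (by ring), mul_zero]
  · intro h; exact absurd (mem_univ c) h

theorem prod_sub_ne_zero (α : Fin (s+1) → ℝ) (hα : StrictMono α) (c : Fin (s+1)) :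
    ∏ c' ∈ univ.erase c, (α c' - α c) ≠ 0 :=
  Finset.prod_ne_zero_iff.mpr fun _ hc' => sub_ne_zero.mpr (hα.injective.ne (Finset.ne_of_mem_erase hc'))

theorem poleSum_eval_neg_ne_zero (α w : Fin (s+1) → ℝ) (hα : StrictMono α) (hw : ∀ c, 0 < w c) (c : Fin (s+1)) :
    (poleSum α w).eval (-α c) ≠ 0 := by
  rw [poleSum_eval_neg]; exact mul_ne_zero (hw c).ne' (prod_sub_ne_zero α hα c)

theorem poleProd_eval_neg (α : Fin (s+1) → ℝ) (c : Fin (s+1)) : (poleProd α).eval (-α c) = 0 := by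
  rw [eval_poleProd]; exact Finset.prod_eq_zero (mem_univ c) (by ring)

theorem derivative_poleProd_eval_neg (α : Fin (s+1) → ℝ) (c : Fin (s+1)) :
    (derivative (poleProd α)).eval (-α c) = ∏ c' ∈ univ.erase c, (α c' - α c) := by
  have h : poleProd α = (X + C (α c)) * ∏ c' ∈ univ.erase c, (X + C (α c')) :=
    (Finset.mul_prod_erase univ (fun c' => X + C (α c')) (mem_univ c)).symm
  rw [h, derivative_mul]
  simp only [derivative_add, derivative_X, derivative_C, add_zero, one_mul, eval_add, eval_mul, eval_X, eval_C,
    neg_add_cancel, zero_mul, eval_prod]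
  exact Finset.prod_congr rfl fun _ _ => by ring

theorem poleProd_eval_ne_zero (α : Fin (s+1) → ℝ) {u : ℝ} (hu : ∀ c, u + α c ≠ 0) : (poleProd α).eval u ≠ 0 := by
  rw [eval_poleProd]; exact Finset.prod_ne_zero_iff.mpr fun c _ => hu c

/-- The Stieltjes function `G̃(u) = Σ_c w_c/(u + α_c)`. -/
noncomputable def Gt (α w : Fin (s+1) → ℝ) (u : ℝ) : ℝ := ∑ c, w c * (u + α c)⁻¹

theorem poleSum_eval_eq_mul_Gt (α w : Fin (s+1) → ℝ) {u : ℝ} (hu : ∀ c, u + α c ≠ 0) :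
    (poleSum α w).eval u = (poleProd α).eval u * Gt α w u := by
  rw [eval_poleSum, eval_poleProd, Gt, Finset.mul_sum]
  refine Finset.sum_congr rfl fun c _ => ?_
  rw [← Finset.mul_prod_erase univ (fun c' => u + α c') (mem_univ c)]
  have := hu c
  field_simp

theorem hasDerivAt_Gt (α w : Fin (s+1) → ℝ) {u : ℝ} (hu : ∀ c, u + α c ≠ 0) :
    HasDerivAt (Gt α w) (∑ c, w c * (-(1 : ℝ) / (u + α c) ^ 2)) u := by
  unfold Gt
  refine HasDerivAt.fun_sum fun c _ => ?_
  exact (((hasDerivAt_id u).add_const (α c)).inv (hu c)).const_mul (w c)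

theorem Gt_deriv_neg (α w : Fin (s+1) → ℝ) (hw : ∀ c, 0 < w c) {u : ℝ} (hu : ∀ c, u + α c ≠ 0) :
    ∑ c, w c * (-(1 : ℝ) / (u + α c) ^ 2) < 0 := by
  have key : ∀ c ∈ (univ : Finset (Fin (s+1))), w c * (-(1 : ℝ) / (u + α c) ^ 2) < 0 := fun c _ => by
    have h1 : 0 < (u + α c) ^ 2 := by have := hu c; positivity
    exact mul_neg_of_pos_of_neg (hw c) (div_neg_of_neg_of_pos neg_one_lt_zero h1)
  exact Finset.sum_neg key univ_nonempty

/-- At a zero `z` of `P̂` off the poles: `P̂'(z) = Π̂(z)·G̃'(z) ≠ 0` (strict monotonicity of the Stieltjes function). -/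
theorem derivative_poleSum_eval_ne_zero (α w : Fin (s+1) → ℝ) (hw : ∀ c, 0 < w c) {z : ℝ}
    (hz : ∀ c, z + α c ≠ 0) (hroot : (poleSum α w).eval z = 0) : (derivative (poleSum α w)).eval z ≠ 0 := by
  have hPP : (poleProd α).eval z ≠ 0 := poleProd_eval_ne_zero α hz
  have hGz : Gt α w z = 0 := by
    have := poleSum_eval_eq_mul_Gt α w hz
    rw [hroot] at this
    exact (mul_eq_zero.mp this.symm).resolve_left hPP
  have hopen : IsOpen {u : ℝ | (poleProd α).eval u ≠ 0} := isOpen_ne_fun (poleProd α).continuous continuous_const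
  have heq : (fun u => (poleSum α w).eval u) =ᶠ[nhds z] fun u => (poleProd α).eval u * Gt α w u := by
    filter_upwards [hopen.mem_nhds hPP] with u hu
    refine poleSum_eval_eq_mul_Gt α w fun c h => hu ?_
    rw [eval_poleProd]; exact Finset.prod_eq_zero (mem_univ c) h
  have h1 : HasDerivAt (fun u => (poleProd α).eval u * Gt α w u)
      ((derivative (poleProd α)).eval z * Gt α w z
        + (poleProd α).eval z * ∑ c, w c * (-(1 : ℝ) / (z + α c) ^ 2)) z :=
    ((poleProd α).hasDerivAt z).mul (hasDerivAt_Gt α w hz)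
  have h3 := ((poleSum α w).hasDerivAt z).unique (h1.congr_of_eventuallyEq heq)
  rw [h3, hGz, mul_zero, zero_add]
  exact mul_ne_zero hPP (Gt_deriv_neg α w hw hz).ne

/-- Consecutive poles give `P̂` opposite signs. -/
theorem poleSum_eval_neg_mul_neg (α w : Fin (s+1) → ℝ) (hα : StrictMono α) (hw : ∀ c, 0 < w c) (i : Fin s) :
    (poleSum α w).eval (-α i.castSucc) * (poleSum α w).eval (-α i.succ) < 0 := by
  have hlt : i.castSucc < i.succ := Fin.castSucc_lt_succ (i := i)
  have hab : i.castSucc ≠ i.succ := hlt.ne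
  have hαab : α i.castSucc < α i.succ := hα hlt
  rw [poleSum_eval_neg, poleSum_eval_neg]
  have hb : i.succ ∈ univ.erase i.castSucc := mem_erase.mpr ⟨hab.symm, mem_univ _⟩
  have ha : i.castSucc ∈ univ.erase i.succ := mem_erase.mpr ⟨hab, mem_univ _⟩
  rw [← Finset.mul_prod_erase _ _ hb, ← Finset.mul_prod_erase _ _ ha,
    show (univ.erase i.succ).erase i.castSucc = (univ.erase i.castSucc).erase i.succ from Finset.erase_right_comm]
  set S := (univ.erase i.castSucc).erase i.succ with hS
  have hpos : 0 < (∏ c' ∈ S, (α c' - α i.castSucc)) * ∏ c' ∈ S, (α c' - α i.succ) := by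
    rw [← Finset.prod_mul_distrib]
    refine Finset.prod_pos fun c' hc' => ?_
    have h1 : c' ≠ i.succ := Finset.ne_of_mem_erase hc'
    have h2 : c' ≠ i.castSucc := Finset.ne_of_mem_erase (Finset.mem_of_mem_erase hc')
    have h1' : c'.val ≠ i.val + 1 := fun h => h1 (Fin.ext (by simp [h]))
    have h2' : c'.val ≠ i.val := fun h => h2 (Fin.ext (by simp [h]))
    rcases Nat.lt_or_gt_of_ne h2' with h | h
    · have hc : α c' < α i.castSucc := hα (Fin.lt_def.mpr (by simpa using h))
      nlinarith
    · have h' : i.val + 1 < c'.val := by omega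
      have hc : α i.succ < α c' := hα (Fin.lt_def.mpr (by simpa [Fin.val_succ] using h'))
      nlinarith
  have hw2 := mul_pos (hw i.castSucc) (hw i.succ)
  have hd : 0 < (α i.succ - α i.castSucc) ^ 2 := by nlinarith
  have : w i.castSucc * ((α i.succ - α i.castSucc) * ∏ c' ∈ S, (α c' - α i.castSucc))
      * (w i.succ * ((α i.castSucc - α i.succ) * ∏ c' ∈ S, (α c' - α i.succ)))
      = -((w i.castSucc * w i.succ) * (α i.succ - α i.castSucc) ^ 2
          * ((∏ c' ∈ S, (α c' - α i.castSucc)) * ∏ c' ∈ S, (α c' - α i.succ))) := by ring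
  rw [this, neg_lt_zero]
  positivity

/-- A zero of `P̂` strictly inside each gap between consecutive poles (IVT). -/
theorem exists_root_gap (α w : Fin (s+1) → ℝ) (hα : StrictMono α) (hw : ∀ c, 0 < w c) (i : Fin s) :
    ∃ z, -α i.succ < z ∧ z < -α i.castSucc ∧ (poleSum α w).eval z = 0 := by
  have hlt : -α i.succ < -α i.castSucc := neg_lt_neg (hα (Fin.castSucc_lt_succ (i := i)))
  have hcont : ContinuousOn (fun u => (poleSum α w).eval u) (Set.Icc (-α i.succ) (-α i.castSucc)) :=
    (poleSum α w).continuousOn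
  rcases mul_neg_iff.mp (poleSum_eval_neg_mul_neg α w hα hw i) with ⟨h1, h2⟩ | ⟨h1, h2⟩
  · obtain ⟨z, hz, hz0⟩ := intermediate_value_Ioo hlt.le hcont ⟨h2, h1⟩
    exact ⟨z, hz.1, hz.2, hz0⟩
  · obtain ⟨z, hz, hz0⟩ := intermediate_value_Ioo' hlt.le hcont ⟨h1, h2⟩
    exact ⟨z, hz.1, hz.2, hz0⟩

theorem gap_no_pole (α : Fin (s+1) → ℝ) (hα : StrictMono α) (i : Fin s) {z : ℝ}
    (h1 : -α i.succ < z) (h2 : z < -α i.castSucc) (c : Fin (s+1)) : z + α c ≠ 0 := by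
  intro h
  rcases le_or_gt c.val i.val with hc | hc
  · have : α c ≤ α i.castSucc := hα.monotone (Fin.le_iff_val_le_val.mpr (by simpa using hc))
    linarith
  · have : α i.succ ≤ α c := hα.monotone (Fin.le_iff_val_le_val.mpr (by simpa [Fin.val_succ] using hc))
    linarith

/-- Gaps are ordered: for `i < j`, gap `j` lies entirely to the left of gap `i`. -/
theorem gap_order (α : Fin (s+1) → ℝ) (hα : StrictMono α) {i j : Fin s} (hij : i < j) :
    -α j.castSucc ≤ -α i.succ := by
  have : i.succ ≤ j.castSucc := Fin.le_iff_val_le_val.mpr (by simpa [Fin.val_succ] using hij)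
  exact neg_le_neg (hα.monotone this)

theorem exists_root_of_neg_pos (f : ℝ[X]) {a b : ℝ} (hab : a < b) (ha : f.eval a < 0) (hb : 0 < f.eval b) :
    ∃ r, a < r ∧ r < b ∧ f.eval r = 0 := by
  obtain ⟨r, hr, hr0⟩ := intermediate_value_Ioo hab.le f.continuousOn ⟨ha, hb⟩
  exact ⟨r, hr.1, hr.2, hr0⟩

theorem exists_root_of_pos_neg (f : ℝ[X]) {a b : ℝ} (hab : a < b) (ha : 0 < f.eval a) (hb : f.eval b < 0) :
    ∃ r, a < r ∧ r < b ∧ f.eval r = 0 := by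
  obtain ⟨r, hr, hr0⟩ := intermediate_value_Ioo' hab.le f.continuousOn ⟨hb, ha⟩
  exact ⟨r, hr.1, hr.2, hr0⟩

/-- **Pole-count theorem (memo §16).** For `0 < α₀ < … < α_s` and positive weights, the excess
`EE P̂ Π̂` of the partial fraction `Σ_c w_c/(u + α_c)` has at most `2s` distinct positive roots:
it has degree `≤ 4s+1`, vanishes at `0`, is `> 0` at the `s+1` poles `−α_c` and `< 0` at the `s` interlacing zeros of `P̂`,
whence `2s` distinct negative roots. -/
theorem posRoots_EE_poleSum_le (α w : Fin (s+1) → ℝ) (hα : StrictMono α) (hα0 : ∀ c, 0 < α c)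
    (hw : ∀ c, 0 < w c) : posRoots (EE (poleSum α w) (poleProd α)) ≤ 2 * s := by
  classical
  set E := EE (poleSum α w) (poleProd α) with hE
  -- signs at the poles
  have hpole : ∀ c, 0 < E.eval (-α c) := fun c =>
    EE_eval_pos_of_root_right _ _ (neg_ne_zero.mpr (hα0 c).ne') (poleProd_eval_neg α c)
      (poleSum_eval_neg_ne_zero α w hα hw c) (by rw [derivative_poleProd_eval_neg]; exact prod_sub_ne_zero α hα c)
  have hE0 : E ≠ 0 := fun h => by have := hpole 0; rw [h, eval_zero] at this; exact lt_irrefl _ this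
  -- zeros of P̂ in the gaps and the sign there
  choose z hz1 hz2 hz0 using exists_root_gap α w hα hw
  have hzneg : ∀ i, E.eval (z i) < 0 := fun i => by
    have hzp : ∀ c, z i + α c ≠ 0 := gap_no_pole α hα i (hz1 i) (hz2 i)
    have hzi : z i ≠ 0 := by
      have : -α i.castSucc < 0 := neg_neg_of_pos (hα0 _)
      exact (lt_trans (hz2 i) this).ne
    exact EE_eval_neg_of_root_left _ _ hzi (hz0 i) (poleProd_eval_ne_zero α hzp)
      (derivative_poleSum_eval_ne_zero α w hw hzp (hz0 i))
  -- two roots of E per gap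
  choose rp hrp1 hrp2 hrp0 using fun i => exists_root_of_neg_pos E (hz2 i) (hzneg i) (hpole i.castSucc)
  choose rm hrm1 hrm2 hrm0 using fun i => exists_root_of_pos_neg E (hz1 i) (hpole i.succ) (hzneg i)
  -- ordering facts
  have hrp_anti : StrictAnti rp := fun i j hij =>
    calc rp j < -α j.castSucc := hrp2 j
      _ ≤ -α i.succ := gap_order α hα hij
      _ < z i := hz1 i
      _ < rp i := hrp1 i
  have hrm_anti : StrictAnti rm := fun i j hij =>
    calc rm j < z j := hrm2 j
      _ < -α j.castSucc := hz2 j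
      _ ≤ -α i.succ := gap_order α hα hij
      _ < rm i := hrm1 i
  have hdisj : Disjoint (univ.image rp) (univ.image rm) := by
    refine Finset.disjoint_left.mpr fun x hx hx' => ?_
    obtain ⟨i, _, rfl⟩ := Finset.mem_image.mp hx
    obtain ⟨j, _, hj⟩ := Finset.mem_image.mp hx'
    rcases lt_trichotomy i j with h | rfl | h
    · have : rm j < rp i :=
        calc rm j < z j := hrm2 j
          _ < -α j.castSucc := hz2 j
          _ ≤ -α i.succ := gap_order α hα h
          _ < z i := hz1 i
          _ < rp i := hrp1 i
      exact this.ne hj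
    · exact ((hrm2 i).trans (hrp1 i)).ne hj
    · have : rp i < rm j :=
        calc rp i < -α i.castSucc := hrp2 i
          _ ≤ -α j.succ := gap_order α hα h
          _ < rm j := hrm1 j
      exact this.ne' hj
  -- the forced non-positive roots
  set R : Finset ℝ := insert 0 (univ.image rp ∪ univ.image rm) with hR
  have hneg : ∀ x ∈ univ.image rp ∪ univ.image rm, x < 0 := by
    intro x hx
    rcases Finset.mem_union.mp hx with hx | hx
    · obtain ⟨i, _, rfl⟩ := Finset.mem_image.mp hx
      exact (hrp2 i).trans (neg_neg_of_pos (hα0 _))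
    · obtain ⟨i, _, rfl⟩ := Finset.mem_image.mp hx
      exact ((hrm2 i).trans (hz2 i)).trans (neg_neg_of_pos (hα0 _))
  have hRcard : R.card = 2 * s + 1 := by
    rw [hR, Finset.card_insert_of_notMem fun h => lt_irrefl (0 : ℝ) (hneg 0 h), Finset.card_union_of_disjoint hdisj,
      Finset.card_image_of_injective _ hrp_anti.injective, Finset.card_image_of_injective _ hrm_anti.injective]
    simp; ring
  have hRsub : R ⊆ E.roots.toFinset.filter (fun t => ¬ 0 < t) := by
    intro x hx
    rw [Finset.mem_filter, Multiset.mem_toFinset, mem_roots hE0, IsRoot.def]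
    rcases Finset.mem_insert.mp hx with rfl | hx
    · exact ⟨EE_eval_zero _ _, lt_irrefl 0⟩
    · refine ⟨?_, not_lt.mpr (hneg x hx).le⟩
      rcases Finset.mem_union.mp hx with hx | hx
      · obtain ⟨i, _, rfl⟩ := Finset.mem_image.mp hx; exact hrp0 i
      · obtain ⟨i, _, rfl⟩ := Finset.mem_image.mp hx; exact hrm0 i
  -- count
  have hdeg : E.natDegree ≤ 4 * s + 1 :=
    natDegree_EE_le _ _ s (natDegree_poleSum_le α w) (natDegree_poleProd_le α)
  have h1 : E.roots.toFinset.card ≤ 4 * s + 1 :=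
    (Multiset.toFinset_card_le _).trans ((Polynomial.card_roots' E).trans hdeg)
  have h2 := Finset.card_le_card hRsub
  have h3 := Finset.card_filter_add_card_filter_not (s := E.roots.toFinset) (fun t : ℝ => 0 < t)
  rw [hRcard] at h2
  show (E.roots.toFinset.filter (fun t => 0 < t)).card ≤ 2 * s
  omega

end Poles

/-! #### bridge: `E(q) = EE P Π`, substitution `u = X^D`, stripping `X`-powers and constants, fibres -/

theorem sumLetterExcessGen_eq_EE (q : Fin m → ℝ[X]) : sumLetterExcessGen q = EE (coprodSum q) (∏ j, q j) := by
  rw [sumLetterExcessGen, EE, lagVar_prod]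

theorem thetaOp_C_mul (c : ℝ) (f : ℝ[X]) : thetaOp (C c * f) = C c * thetaOp f := by
  simp only [thetaOp, derivative_mul, derivative_C, zero_mul, zero_add]; ring

theorem thetaOp_X_pow (n : ℕ) : thetaOp ((X : ℝ[X]) ^ n) = C (n : ℝ) * X ^ n := by
  rw [thetaOp, derivative_X_pow, X_mul_C_mul_X_pow_pred]

theorem lagVar_X_pow (n : ℕ) : lagVar ((X : ℝ[X]) ^ n) = 0 := by
  rw [lagVar, thetaOp_X_pow, thetaOp_C_mul, thetaOp_X_pow]; ring

theorem lagVar_X_pow_mul (n : ℕ) (f : ℝ[X]) : lagVar (X ^ n * f) = X ^ (2 * n) * lagVar f := by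
  rw [lagVar_mul, lagVar_X_pow, zero_mul, zero_add, pow_mul']

theorem EE_X_pow_mul (a b : ℕ) (F G : ℝ[X]) : EE (X ^ a * F) (X ^ b * G) = X ^ (2 * a + 2 * b) * EE F G := by
  simp only [EE, lagVar_X_pow_mul]; ring

theorem thetaOp_comp_X_pow (f : ℝ[X]) (D : ℕ) : thetaOp (f.comp (X ^ D)) = C (D : ℝ) * (thetaOp f).comp (X ^ D) := by
  rw [thetaOp, thetaOp, derivative_comp, derivative_X_pow, mul_comp, X_comp, ← mul_assoc, X_mul_C_mul_X_pow_pred, mul_assoc]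

theorem lagVar_comp_X_pow (f : ℝ[X]) (D : ℕ) : lagVar (f.comp (X ^ D)) = C ((D : ℝ) ^ 2) * (lagVar f).comp (X ^ D) := by
  rw [lagVar, thetaOp_comp_X_pow, thetaOp_C_mul, thetaOp_comp_X_pow, lagVar, sub_comp, mul_comp, pow_comp, map_pow]; ring

theorem EE_comp_X_pow (F G : ℝ[X]) (D : ℕ) :
    EE (F.comp (X ^ D)) (G.comp (X ^ D)) = C ((D : ℝ) ^ 2) * (EE F G).comp (X ^ D) := by
  rw [EE, EE, lagVar_comp_X_pow, lagVar_comp_X_pow, sub_comp, mul_comp, mul_comp, pow_comp, pow_comp]; ring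

theorem EE_C_mul_right (c : ℝ) (P Q : ℝ[X]) : EE P (C c * Q) = C c ^ 2 * EE P Q := by
  rw [EE, EE, lagVar_C_mul]; ring

theorem posRoots_C_mul {c : ℝ} (hc : c ≠ 0) (f : ℝ[X]) : posRoots (C c * f) = posRoots f := by
  unfold posRoots; rw [roots_C_mul _ hc]

theorem posRoots_X_pow_mul (n : ℕ) (f : ℝ[X]) : posRoots (X ^ n * f) = posRoots f := by
  induction n with
  | zero => rw [pow_zero, one_mul]
  | succ n ih => rw [pow_succ', mul_assoc, posRoots_X_mul, ih]

/-- A factor without positive roots does not change `posRoots`. -/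
theorem posRoots_mul_of_eval_ne_zero (M F : ℝ[X]) (hM : ∀ t : ℝ, 0 < t → M.eval t ≠ 0) :
    posRoots (M * F) = posRoots F := by
  classical
  by_cases hF : F = 0
  · simp [posRoots, hF]
  have hM0 : M ≠ 0 := fun h => hM 1 one_pos (by rw [h, eval_zero])
  unfold posRoots
  rw [roots_mul (mul_ne_zero hM0 hF), Multiset.toFinset_add, Finset.filter_union]
  have hempty : M.roots.toFinset.filter (fun t => 0 < t) = ∅ :=
    Finset.filter_eq_empty_iff.mpr fun t ht ht0 => hM t ht0 ((mem_roots hM0).mp (Multiset.mem_toFinset.mp ht))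
  rw [hempty, Finset.empty_union]

/-- `t ↦ t^D` is a bijection of the positive roots of `f ∘ X^D` onto those of `f` (`D ≥ 1`). -/
theorem posRoots_comp_X_pow (f : ℝ[X]) {D : ℕ} (hD : 0 < D) : posRoots (f.comp (X ^ D)) = posRoots f := by
  classical
  by_cases hf : f = 0
  · simp [hf]
  have hc : f.comp (X ^ D) ≠ 0 := by
    intro h
    rcases comp_eq_zero_iff.mp h with h | ⟨_, h2⟩
    · exact hf h
    · have := congrArg natDegree h2
      rw [natDegree_X_pow, natDegree_C] at this
      omega
  unfold posRoots
  refine Finset.card_nbij (fun t => t ^ D) ?_ ?_ ?_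
  · intro t ht
    simp only [Finset.coe_filter, Set.mem_setOf_eq, Multiset.mem_toFinset, mem_roots hc, mem_roots hf, IsRoot.def,
      eval_comp, eval_pow, eval_X] at ht ⊢
    exact ⟨ht.1, pow_pos ht.2 D⟩
  · intro t₁ ht₁ t₂ ht₂ h
    simp only [Finset.coe_filter, Set.mem_setOf_eq] at ht₁ ht₂
    exact (pow_left_inj₀ ht₁.2.le ht₂.2.le hD.ne').mp h
  · intro u hu
    simp only [Finset.coe_filter, Set.mem_setOf_eq, Multiset.mem_toFinset, mem_roots hf, IsRoot.def] at hu
    refine ⟨u ^ ((D : ℝ)⁻¹), ?_, Real.rpow_inv_natCast_pow hu.2.le hD.ne'⟩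
    simp only [Finset.coe_filter, Set.mem_setOf_eq, Multiset.mem_toFinset, mem_roots hc, IsRoot.def, eval_comp,
      eval_pow, eval_X, Real.rpow_inv_natCast_pow hu.2.le hD.ne']
    exact ⟨hu.1, Real.rpow_pos_of_pos hu.2 _⟩

/-- **Pole count, Finset form:** poles `T ⊂ (0,∞)`, positive weights; automatically sorted by `orderEmbOfFin`. -/
theorem posRoots_EE_finset_le (T : Finset ℝ) (W : ℝ → ℝ) (hT : ∀ t ∈ T, 0 < t) (hW : ∀ t ∈ T, 0 < W t) :
    posRoots (EE (∑ t ∈ T, C (W t) * ∏ t' ∈ T.erase t, (X + C t')) (∏ t ∈ T, (X + C t))) ≤ 2 * (T.card - 1) := by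
  classical
  rcases Nat.eq_zero_or_pos T.card with h0 | hpos
  · rw [Finset.card_eq_zero.mp h0]
    simp [EE, posRoots, lagVar, thetaOp]
  obtain ⟨s, hs⟩ : ∃ s, T.card = s + 1 := ⟨T.card - 1, by omega⟩
  set α : Fin (s+1) ↪o ℝ := T.orderEmbOfFin hs with hαdef
  have hαT : univ.image (fun c => α c) = T := Finset.image_orderEmbOfFin_univ T hs
  have hinj : Function.Injective (fun c => α c) := α.injective
  have hprod : ∏ t ∈ T, (X + C t) = poleProd (fun c => α c) := by
    rw [poleProd, ← hαT, Finset.prod_image fun c _ c' _ h => hinj h]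
  have hsum : ∑ t ∈ T, C (W t) * ∏ t' ∈ T.erase t, (X + C t') = poleSum (fun c => α c) (fun c => W (α c)) := by
    rw [poleSum, ← hαT, Finset.sum_image fun c _ c' _ h => hinj h]
    refine Finset.sum_congr rfl fun c _ => ?_
    rw [← Finset.image_erase hinj, Finset.prod_image fun c _ c' _ h => hinj h]
  rw [hprod, hsum, hs, Nat.add_sub_cancel]
  exact posRoots_EE_poleSum_le _ _ α.strictMono (fun c => hT _ (T.orderEmbOfFin_mem hs c))
    (fun c => hW _ (T.orderEmbOfFin_mem hs c))

/-- **Linear letters (the `u`-picture of K = 2), coincident ratios allowed:** regroup by the ratio `r = a/b`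
(fibres), pull the common factor `M = ∏_t (X + t)^{n_t − 1}` out as `M⁴` (`EE_mul_left`), and count on the reduced data. -/
theorem posRoots_EE_linear (a b : Fin m → ℝ) (ha : ∀ i, 0 < a i) (hb : ∀ i, 0 < b i) :
    posRoots (EE (coprodSum fun i => C (a i) + C (b i) * X) (∏ i, (C (a i) + C (b i) * X))) ≤ 2 * (m - 1) := by
  classical
  obtain ⟨r, hr⟩ : ∃ r : Fin m → ℝ, r = fun i => a i / b i := ⟨_, rfl⟩
  have hr0 : ∀ i, 0 < r i := fun i => by rw [hr]; exact div_pos (ha i) (hb i)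
  have hL : ∀ i, C (a i) + C (b i) * X = C (b i) * (X + C (r i)) := fun i => by
    rw [hr, mul_add, ← map_mul, mul_div_cancel₀ _ (hb i).ne']; ring
  obtain ⟨T, hT⟩ : ∃ T : Finset ℝ, T = univ.image r := ⟨_, rfl⟩
  have hmaps : ∀ i ∈ (univ : Finset (Fin m)), r i ∈ T := fun i _ => hT ▸ mem_image_of_mem r (mem_univ i)
  have hTpos : ∀ t ∈ T, 0 < t := fun t ht => by
    obtain ⟨i, _, rfl⟩ := Finset.mem_image.mp (hT ▸ ht); exact hr0 i
  have hn_pos : ∀ t ∈ T, (univ.filter fun i => r i = t).card ≠ 0 := fun t ht => by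
    obtain ⟨i, _, hi⟩ := Finset.mem_image.mp (hT ▸ ht)
    exact (Finset.card_pos.mpr ⟨i, mem_filter.mpr ⟨mem_univ i, hi⟩⟩).ne'
  obtain ⟨M, hM⟩ : ∃ M : ℝ[X], M = ∏ t ∈ T, (X + C t) ^ ((univ.filter fun i => r i = t).card - 1) := ⟨_, rfl⟩
  -- (F1) the product regrouped by fibres
  have hF1 : ∏ i, (X + C (r i)) = M * ∏ t ∈ T, (X + C t) := by
    rw [← Finset.prod_fiberwise_of_maps_to hmaps (fun i => X + C (r i)), hM, ← Finset.prod_mul_distrib]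
    refine Finset.prod_congr rfl fun t ht => ?_
    rw [pow_sub_one_mul (hn_pos t ht), Finset.prod_congr rfl fun i hi => by rw [(mem_filter.mp hi).2], Finset.prod_const]
  -- (F2') every letter-coproduct carries the factor `M`
  have hF2 : ∀ i, ∏ j ∈ univ.erase i, (X + C (r j)) = M * ∏ t' ∈ T.erase (r i), (X + C t') := by
    intro i
    apply mul_left_cancel₀ (X_add_C_ne_zero (r i))
    rw [Finset.mul_prod_erase univ (fun j => X + C (r j)) (mem_univ i), hF1, mul_left_comm,
      Finset.mul_prod_erase T (fun t => X + C t) (hmaps i (mem_univ i))]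
  -- the product of the letters
  have hprod : ∏ i, (C (a i) + C (b i) * X) = M * (C (∏ i, b i) * ∏ t ∈ T, (X + C t)) := by
    simp only [hL]
    rw [Finset.prod_mul_distrib, ← map_prod C, hF1]; ring
  -- the coproduct sum of the letters, with weights `v i = ∏_{j≠i} b j` and fibre sums `W`
  obtain ⟨W, hW⟩ : ∃ W : ℝ → ℝ, W = fun t => ∑ i ∈ univ.filter (fun i => r i = t), ∏ j ∈ univ.erase i, b j := ⟨_, rfl⟩
  have hWpos : ∀ t ∈ T, 0 < W t := fun t ht => by
    obtain ⟨i, _, hi⟩ := Finset.mem_image.mp (hT ▸ ht)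
    rw [hW]
    exact Finset.sum_pos (fun j _ => Finset.prod_pos fun k _ => hb k) ⟨i, mem_filter.mpr ⟨mem_univ i, hi⟩⟩
  have hcop : coprodSum (fun i => C (a i) + C (b i) * X) = M * ∑ t ∈ T, C (W t) * ∏ t' ∈ T.erase t, (X + C t') := by
    unfold coprodSum
    simp only [hL]
    have step : ∀ i, ∏ j ∈ univ.erase i, C (b j) * (X + C (r j))
        = M * (C (∏ j ∈ univ.erase i, b j) * ∏ t' ∈ T.erase (r i), (X + C t')) := fun i => by
      rw [Finset.prod_mul_distrib, ← map_prod C, hF2]; ring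
    simp only [step]
    rw [← Finset.mul_sum, ← Finset.sum_fiberwise_of_maps_to hmaps]
    congr 1
    refine Finset.sum_congr rfl fun t _ => ?_
    rw [hW, map_sum, Finset.sum_mul]
    refine Finset.sum_congr rfl fun i hi => ?_
    rw [(mem_filter.mp hi).2]
  -- assemble
  have hMeval : ∀ t : ℝ, 0 < t → (M ^ 4).eval t ≠ 0 := fun t ht => by
    rw [eval_pow, hM, eval_prod]
    refine pow_ne_zero _ (Finset.prod_pos fun t' ht' => ?_).ne'
    rw [eval_pow, eval_add, eval_X, eval_C]
    exact pow_pos (add_pos ht (hTpos t' ht')) _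
  have hβ : (∏ i, b i) ≠ 0 := (Finset.prod_pos fun i _ => hb i).ne'
  have hcard : T.card ≤ m := by
    rw [hT]; exact Finset.card_image_le.trans (by simp)
  rw [hcop, hprod, EE_mul_left, posRoots_mul_of_eval_ne_zero _ _ hMeval, EE_C_mul_right, ← map_pow,
    posRoots_C_mul (pow_ne_zero 2 hβ)]
  exact (posRoots_EE_finset_le T W hTpos hWpos).trans (by omega)

/-- The two letters of a K = 2 design: `q_i = X^{d 0} · (C a_i + C b_i X) ∘ X^D` with `d 1 = d 0 + D`. -/
theorem letterPoly_two_eq (d : Fin 2 → ℕ) (p : Fin 2 → Fin m → ℝ) (i : Fin m) (D : ℕ) (hD : d 1 = d 0 + D) :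
    letterPoly d p i = X ^ d 0 * (C (p 0 i) + C (p 1 i) * X).comp (X ^ D) := by
  unfold letterPoly
  rw [Fin.sum_univ_two, hD]
  simp only [add_comp, mul_comp, C_comp, X_comp]
  ring

/-- **THEOREM IB(m,2), every `m` (memo §16: pole counting; coincident ratios included).** -/
theorem inflectionBudget_K_two (m : ℕ) : InflectionBudget m 2 := by
  classical
  rw [inflectionBudget_iff_sumLetter]
  intro d p hd hp
  have h01 : d 0 < d 1 := hd (show (0 : Fin 2) < 1 by decide)
  obtain ⟨D, hD⟩ : ∃ D, d 1 = d 0 + D := ⟨d 1 - d 0, by omega⟩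
  have hDpos : 0 < D := by omega
  have hq : letterPoly d p = fun i => X ^ d 0 * (C (p 0 i) + C (p 1 i) * X).comp (X ^ D) :=
    funext fun i => letterPoly_two_eq d p i D hD
  have hprod : ∏ j, letterPoly d p j = X ^ (m * d 0) * (∏ j, (C (p 0 j) + C (p 1 j) * X)).comp (X ^ D) := by
    rw [hq]
    simp only []
    rw [Finset.prod_mul_distrib, Finset.prod_const, Finset.card_univ, Fintype.card_fin, ← pow_mul, mul_comm (d 0) m,
      Polynomial.prod_comp]
  have hcop : coprodSum (letterPoly d p)
      = X ^ ((m - 1) * d 0) * (coprodSum fun j => C (p 0 j) + C (p 1 j) * X).comp (X ^ D) := by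
    unfold coprodSum
    rw [hq, Polynomial.sum_comp, Finset.mul_sum]
    refine Finset.sum_congr rfl fun i _ => ?_
    simp only []
    rw [Finset.prod_mul_distrib, Finset.prod_const, Finset.card_erase_of_mem (mem_univ i), Finset.card_univ,
      Fintype.card_fin, ← pow_mul, mul_comm (d 0), Polynomial.prod_comp]
  rw [sumLetterExcessGen_eq_EE, hcop, hprod, EE_X_pow_mul, EE_comp_X_pow, posRoots_X_pow_mul,
    posRoots_C_mul (by positivity), posRoots_comp_X_pow _ hDpos]
  simpa using posRoots_EE_linear (fun i => p 0 i) (fun i => p 1 i) (fun i => hp 0 i) (fun i => hp 1 i)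


/-- Hence CKB(m,2) for every `m` … -/
theorem commCriticalBudget_K_two (m : ℕ) : CommCriticalBudget m 2 :=
  commCriticalBudget_of_inflectionBudget (inflectionBudget_K_two m)

/-- … and the commuting located one-law COMM(m,2) `≤ 2(m−1) + 2` for every `m`, now THROUGH the law IB
(by degree these cells were never in doubt; the content is the route). -/
theorem commOneLawSharp_K_two (m : ℕ) : CommOneLawSharp m 2 :=
  commOneLawSharp_of_inflectionBudget (by norm_num) (inflectionBudget_K_two m)


/-! ### v1.1 (gen 11) — SUPPORT AFFINITIES and the BOUNDARY ROWS of the inflection law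

(i) The positive-root count of the inflection Wronskian is INVARIANT under the support affinities `d ↦ c + N·d` (`N ≥ 1`): the letters become
`X^c · q_i(X^N)`, common powers of `X` factor out of `E(q)` (`sumLetterExcessGen_X_pow_mul`), and `u = X^N` rescales `E` by `N²` and maps positive
roots bijectively (`sumLetterExcessGen_comp_X_pow`, `posRoots_comp_X_pow`).  Hence every instance of IB transfers both ways along `d ↦ c + N·d`
(`posRoots_inflWronskian_affine`); in particular the inflection count on EVERY arithmetic-progression support `(c, c+N, c+2N)` is the count of the
dense cell `(0,1,2)` (`posRoots_inflWronskian_AP_three`) — crit-2 #46 (P1): success at (0,1,2) transfers to all AP supports, failure on any AP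
support lands at (0,1,2).
(ii) The boundary rows are theorems: `K ≤ 1` (the Wronskian vanishes identically: no letters, or monomial letters with `S₀ = d₀·A`) and `m ≤ 1`
(`E = −lagVar q₀`, and the θ-Laguerre form of a positive letter evaluates to `q₀(t)·Σ_l x_l (d_l − μ)²`, `x_l = p_l t^{d_l}`, `μ` the exponent mean:
the VARIANCE identity behind memo Thm B, `eval_lagVar_letterPoly`, positive on `(0,∞)` as soon as `K ≥ 2`).  With §4: **IB(m,K) is a theorem
whenever `m ≤ 1` or `K ≤ 2`**; the located region is exactly `m ≥ 2 ∧ K ≥ 3`. -/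

theorem letterPoly_affine (d : Fin K → ℕ) (p : Fin K → Fin m → ℝ) (c N : ℕ) (i : Fin m) :
    letterPoly (fun l => c + N * d l) p i = X ^ c * (letterPoly d p i).comp (X ^ N) := by
  unfold letterPoly
  rw [Polynomial.sum_comp, Finset.mul_sum]
  refine Finset.sum_congr rfl fun l _ => ?_
  rw [mul_comp, C_comp, X_pow_comp, ← pow_mul, pow_add, pow_mul]
  ring

theorem coprodSum_X_pow_mul (c : ℕ) (q : Fin m → ℝ[X]) :
    coprodSum (fun i => X ^ c * q i) = X ^ (c * (m - 1)) * coprodSum q := by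
  classical
  unfold coprodSum
  rw [Finset.mul_sum]
  refine Finset.sum_congr rfl fun i _ => ?_
  rw [Finset.prod_mul_distrib, Finset.prod_const, Finset.card_erase_of_mem (mem_univ i), Finset.card_univ,
    Fintype.card_fin, ← pow_mul]

theorem prod_X_pow_mul (c : ℕ) (q : Fin m → ℝ[X]) : ∏ i, X ^ c * q i = X ^ (c * m) * ∏ i, q i := by
  rw [Finset.prod_mul_distrib, Finset.prod_const, Finset.card_univ, Fintype.card_fin, ← pow_mul]

theorem coprodSum_comp (q : Fin m → ℝ[X]) (g : ℝ[X]) :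
    coprodSum (fun i => (q i).comp g) = (coprodSum q).comp g := by
  classical
  unfold coprodSum
  rw [Polynomial.sum_comp]
  refine Finset.sum_congr rfl fun i _ => ?_
  rw [Polynomial.prod_comp]

theorem sumLetterExcessGen_X_pow_mul (c : ℕ) (q : Fin m → ℝ[X]) :
    sumLetterExcessGen (fun i => X ^ c * q i) = X ^ (2 * (c * (m - 1)) + 2 * (c * m)) * sumLetterExcessGen q := by
  rw [sumLetterExcessGen_eq_EE, sumLetterExcessGen_eq_EE, coprodSum_X_pow_mul, prod_X_pow_mul, EE_X_pow_mul]

theorem sumLetterExcessGen_comp_X_pow (q : Fin m → ℝ[X]) (D : ℕ) :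
    sumLetterExcessGen (fun i => (q i).comp (X ^ D)) = C ((D : ℝ) ^ 2) * (sumLetterExcessGen q).comp (X ^ D) := by
  rw [sumLetterExcessGen_eq_EE, sumLetterExcessGen_eq_EE, coprodSum_comp, ← Polynomial.prod_comp, EE_comp_X_pow]

/-- The root count of `E` is invariant under `q_i ↦ X^c · q_i(X^N)`, `N ≥ 1`. -/
theorem posRoots_sumLetterExcessGen_affine (q : Fin m → ℝ[X]) (c N : ℕ) (hN : 0 < N) :
    posRoots (sumLetterExcessGen (fun i => X ^ c * (q i).comp (X ^ N))) = posRoots (sumLetterExcessGen q) := by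
  have hNr : ((N : ℝ) ^ 2) ≠ 0 := by positivity
  rw [sumLetterExcessGen_X_pow_mul c (fun i => (q i).comp (X ^ N)), posRoots_X_pow_mul, sumLetterExcessGen_comp_X_pow,
    posRoots_C_mul hNr, posRoots_comp_X_pow _ hN]

/-- **Support affinities (kernel): the inflection count is invariant under `d ↦ c + N·d`, `N ≥ 1`.** -/
theorem posRoots_inflWronskian_affine (d : Fin K → ℕ) (p : Fin K → Fin m → ℝ) (c N : ℕ) (hN : 0 < N) :
    posRoots (inflWronskian (fun l => c + N * d l) p) = posRoots (inflWronskian d p) := by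
  rw [posRoots_inflWronskian_gen, posRoots_inflWronskian_gen]
  have hq : letterPoly (fun l => c + N * d l) p = fun i => X ^ c * (letterPoly d p i).comp (X ^ N) :=
    funext (letterPoly_affine d p c N)
  rw [hq, posRoots_sumLetterExcessGen_affine _ _ _ hN]

theorem strictMono_affine {d : Fin K → ℕ} (hd : StrictMono d) (c N : ℕ) (hN : 0 < N) :
    StrictMono (fun l => c + N * d l) :=
  fun _ _ h => Nat.add_lt_add_left (Nat.mul_lt_mul_of_pos_left (hd h) hN) c

/-- An IB instance at support `d` gives the instance at every `c + N·d` (and conversely, by the same equality). -/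
theorem inflWronskian_bound_affine_iff (d : Fin K → ℕ) (p : Fin K → Fin m → ℝ) (c N B : ℕ) (hN : 0 < N) :
    posRoots (inflWronskian (fun l => c + N * d l) p) ≤ B ↔ posRoots (inflWronskian d p) ≤ B := by
  rw [posRoots_inflWronskian_affine d p c N hN]

/-- **The dense cell carries every arithmetic progression (K = 3):** the inflection count on `(c, c+N, c+2N)` equals the count on `(0,1,2)`. -/
theorem posRoots_inflWronskian_AP_three (p : Fin 3 → Fin m → ℝ) (c N : ℕ) (hN : 0 < N) :
    posRoots (inflWronskian (![c, c + N, c + 2 * N] : Fin 3 → ℕ) p) = posRoots (inflWronskian (![0, 1, 2] : Fin 3 → ℕ) p) := by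
  have h : (![c, c + N, c + 2 * N] : Fin 3 → ℕ) = fun l => c + N * (![0, 1, 2] : Fin 3 → ℕ) l := by
    funext l; fin_cases l <;> simp [Nat.mul_comm]
  rw [h, posRoots_inflWronskian_affine _ p c N hN]

/-- IB(m,3) follows on all arithmetic-progression supports from the single dense cell `(0,1,2)` (the first exact target, memo §16.4). -/
theorem inflWronskian_AP_three_le_of_dense {B : ℕ}
    (h : ∀ p : Fin 3 → Fin m → ℝ, (∀ l i, 0 < p l i) → posRoots (inflWronskian (![0, 1, 2] : Fin 3 → ℕ) p) ≤ B)
    (p : Fin 3 → Fin m → ℝ) (hp : ∀ l i, 0 < p l i) (c N : ℕ) (hN : 0 < N) :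
    posRoots (inflWronskian (![c, c + N, c + 2 * N] : Fin 3 → ℕ) p) ≤ B := by
  rw [posRoots_inflWronskian_AP_three p c N hN]; exact h p hp

/-! #### Boundary rows: `K ≤ 1` and `m ≤ 1` -/

theorem posRoots_zero : posRoots (0 : ℝ[X]) = 0 := by simp [posRoots]

theorem posRoots_eq_zero_of_eval_ne_zero (f : ℝ[X]) (h : ∀ t : ℝ, 0 < t → f.eval t ≠ 0) : posRoots f = 0 := by
  classical
  unfold posRoots
  rw [Finset.card_eq_zero, Finset.filter_eq_empty_iff]
  intro t ht hpos
  by_cases hf : f = 0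
  · simp [hf] at ht
  · exact h t hpos ((mem_roots hf).mp (Multiset.mem_toFinset.mp ht))

/-- `K = 0`: no letters, `W = 0`. -/
theorem inflectionBudget_K_zero (m : ℕ) : InflectionBudget m 0 := by
  intro d p _ _
  have hq : ∀ i, letterPoly d p i = 0 := fun i => by simp [letterPoly]
  have hS : critPoly d 0 p = 0 := by simp [critPoly, tiltPoly]
  simp [inflWronskian, hS, posRoots_zero]

/-- `K = 1`: monomial letters; `S₀ = d₀ · A`, so `W = (d₀A)'A − d₀A·A' = 0`. -/
theorem critPoly_zero_K_one (d : Fin 1 → ℕ) (p : Fin 1 → Fin m → ℝ) :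
    critPoly d 0 p = C (d 0 : ℝ) * pencilDir d p := by
  unfold critPoly pencilDir
  rw [Finset.mul_sum]
  refine Finset.sum_congr rfl fun i _ => ?_
  have ht : tiltPoly d 0 p i = C (d 0 : ℝ) * letterPoly d p i := by
    simp only [tiltPoly, letterPoly, Fin.sum_univ_one, Nat.cast_zero, sub_zero, map_mul]
    ring
  rw [ht, mul_assoc]

theorem inflectionBudget_K_one (m : ℕ) : InflectionBudget m 1 := by
  intro d p _ _
  have hW : inflWronskian d p = 0 := by
    rw [inflWronskian, critPoly_zero_K_one, derivative_mul, derivative_C, zero_mul, zero_add]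
    ring
  rw [hW, posRoots_zero]; exact Nat.zero_le _

/-- `m = 0`: no letters at all, `A = 0`, `S₀ = 0`, `W = 0`. -/
theorem inflectionBudget_m_zero (K : ℕ) : InflectionBudget 0 K := by
  intro d p _ _
  have hS : critPoly d 0 p = 0 := by simp [critPoly]
  simp [inflWronskian, hS, posRoots_zero]

/-- `θ` of a letter-shaped sum. -/
theorem thetaOp_sum_C_mul_X_pow (a : Fin K → ℝ) (d : Fin K → ℕ) :
    thetaOp (∑ l, C (a l) * X ^ d l) = ∑ l, C (a l * d l) * X ^ d l := by
  rw [thetaOp_sum]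
  refine Finset.sum_congr rfl fun l _ => ?_
  rw [thetaOp_C_mul, thetaOp_X_pow, map_mul]; ring

theorem eval_sum_C_mul_X_pow (a : Fin K → ℝ) (d : Fin K → ℕ) (t : ℝ) :
    (∑ l, C (a l) * X ^ d l : ℝ[X]).eval t = ∑ l, a l * t ^ d l := by
  simp [eval_finsetSum]

/-- **The variance identity (memo Thm B, kernel):** with `x_l = p_l t^{d_l}`, `Z = Σ x_l`, `S₁ = Σ d_l x_l`, `S₂ = Σ d_l² x_l`,
`(lagVar q)(t) = Z·S₂ − S₁²` ( `= Z·Σ_l x_l (d_l − S₁/Z)²` when `Z ≠ 0`). -/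
theorem eval_lagVar_letterPoly (d : Fin K → ℕ) (p : Fin K → Fin m → ℝ) (i : Fin m) (t : ℝ) :
    (lagVar (letterPoly d p i)).eval t =
      (∑ l, p l i * t ^ d l) * (∑ l, p l i * (d l : ℝ) ^ 2 * t ^ d l) - (∑ l, p l i * d l * t ^ d l) ^ 2 := by
  have h1 : thetaOp (letterPoly d p i) = ∑ l, C (p l i * d l) * X ^ d l := by
    unfold letterPoly; exact thetaOp_sum_C_mul_X_pow _ _
  have h2 : thetaOp (thetaOp (letterPoly d p i)) = ∑ l, C (p l i * d l * d l) * X ^ d l := by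
    rw [h1]; exact thetaOp_sum_C_mul_X_pow _ _
  rw [lagVar, eval_sub, eval_mul, eval_pow, h2, h1]
  unfold letterPoly
  rw [eval_sum_C_mul_X_pow, eval_sum_C_mul_X_pow, eval_sum_C_mul_X_pow]
  have e2 : (∑ l, p l i * (d l : ℝ) * (d l : ℝ) * t ^ d l) = ∑ l, p l i * (d l : ℝ) ^ 2 * t ^ d l :=
    Finset.sum_congr rfl fun l _ => by ring
  rw [e2]

/-- The exponent variance of a positive letter with at least two exponents is positive on `(0,∞)`. -/
theorem lagVar_letterPoly_eval_pos (d : Fin K → ℕ) (p : Fin K → Fin m → ℝ) (hK : 2 ≤ K) (hd : StrictMono d)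
    (hp : ∀ l i, 0 < p l i) (i : Fin m) {t : ℝ} (ht : 0 < t) : 0 < (lagVar (letterPoly d p i)).eval t := by
  rw [eval_lagVar_letterPoly]
  obtain ⟨x, hx⟩ : ∃ x : Fin K → ℝ, ∀ l, x l = p l i * t ^ d l := ⟨_, fun l => rfl⟩
  have hxpos : ∀ l, 0 < x l := fun l => by rw [hx]; exact mul_pos (hp l i) (pow_pos ht _)
  have e1 : (∑ l, p l i * t ^ d l) = ∑ l, x l := Finset.sum_congr rfl fun l _ => (hx l).symm
  have e2 : (∑ l, p l i * (d l : ℝ) ^ 2 * t ^ d l) = ∑ l, x l * (d l : ℝ) ^ 2 :=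
    Finset.sum_congr rfl fun l _ => by rw [hx]; ring
  have e3 : (∑ l, p l i * d l * t ^ d l) = ∑ l, x l * d l := Finset.sum_congr rfl fun l _ => by rw [hx]; ring
  rw [e1, e2, e3]
  obtain ⟨Z, hZ⟩ : ∃ Z : ℝ, Z = ∑ l, x l := ⟨_, rfl⟩
  obtain ⟨S₁, hS₁⟩ : ∃ S : ℝ, S = ∑ l, x l * d l := ⟨_, rfl⟩
  obtain ⟨S₂, hS₂⟩ : ∃ S : ℝ, S = ∑ l, x l * (d l : ℝ) ^ 2 := ⟨_, rfl⟩
  rw [← hZ, ← hS₁, ← hS₂]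
  haveI : Nonempty (Fin K) := ⟨⟨0, by omega⟩⟩
  have hZpos : 0 < Z := by rw [hZ]; exact Finset.sum_pos (fun l _ => hxpos l) Finset.univ_nonempty
  have hZne : Z ≠ 0 := hZpos.ne'
  -- variance form: Z·S₂ − S₁² = Z · Σ_l x_l (d_l − μ)², μ = S₁/Z
  have hvar : Z * S₂ - S₁ ^ 2 = Z * ∑ l, x l * ((d l : ℝ) - S₁ / Z) ^ 2 := by
    have hsum : ∑ l, x l * ((d l : ℝ) - S₁ / Z) ^ 2 = S₂ - 2 * (S₁ / Z) * S₁ + (S₁ / Z) ^ 2 * Z := by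
      have : ∀ l ∈ (Finset.univ : Finset (Fin K)), x l * ((d l : ℝ) - S₁ / Z) ^ 2
          = x l * (d l : ℝ) ^ 2 - 2 * (S₁ / Z) * (x l * d l) + (S₁ / Z) ^ 2 * x l := fun l _ => by ring
      rw [Finset.sum_congr rfl this, Finset.sum_add_distrib, Finset.sum_sub_distrib, ← Finset.mul_sum, ← Finset.mul_sum,
        ← hS₂, ← hS₁, ← hZ]
    rw [hsum]
    field_simp
    ring
  rw [hvar]
  refine mul_pos hZpos ?_
  -- some exponent differs from the mean, because d 0 ≠ d 1
  have hne : (d ⟨0, by omega⟩ : ℝ) ≠ d ⟨1, by omega⟩ := by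
    have := hd (show (⟨0, by omega⟩ : Fin K) < ⟨1, by omega⟩ from Fin.mk_lt_mk.mpr (by norm_num))
    exact_mod_cast this.ne
  obtain ⟨l, hl⟩ : ∃ l : Fin K, (d l : ℝ) ≠ S₁ / Z := by
    by_contra hall
    exact hne ((not_not.mp (not_exists.mp hall _)).trans (not_not.mp (not_exists.mp hall _)).symm)
  have hsq : 0 < ((d l : ℝ) - S₁ / Z) ^ 2 :=
    lt_of_le_of_ne (sq_nonneg _) (Ne.symm (pow_ne_zero 2 (sub_ne_zero.mpr hl)))
  exact Finset.sum_pos' (fun l _ => mul_nonneg (hxpos l).le (sq_nonneg _)) ⟨l, Finset.mem_univ l, mul_pos (hxpos l) hsq⟩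

/-- `m = 1`: `E = −lagVar q₀`, which has no positive roots. -/
theorem sumLetterExcessGen_m_one (q : Fin 1 → ℝ[X]) : sumLetterExcessGen q = -lagVar (q 0) := by
  have hc : coprodSum q = 1 := by
    simp [coprodSum]
  rw [sumLetterExcessGen, hc]
  simp

theorem inflectionBudget_m_one (K : ℕ) : InflectionBudget 1 K := by
  rcases Nat.lt_or_ge K 2 with hK | hK
  · interval_cases K
    · exact inflectionBudget_K_zero 1
    · exact inflectionBudget_K_one 1
  rw [inflectionBudget_iff_sumLetter]
  intro d p hd hp
  rw [sumLetterExcessGen_m_one, posRoots_neg',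
    posRoots_eq_zero_of_eval_ne_zero _ fun t ht => (lagVar_letterPoly_eval_pos d p hK hd hp 0 ht).ne']
  exact Nat.zero_le _

/-- **Summary of the proved region (v1.1):** IB(m,K) holds whenever `m ≤ 1` or `K ≤ 2`. -/
theorem inflectionBudget_of_boundary {m K : ℕ} (h : m ≤ 1 ∨ K ≤ 2) : InflectionBudget m K := by
  rcases h with hm | hK
  · interval_cases m
    · exact inflectionBudget_m_zero K
    · exact inflectionBudget_m_one K
  · interval_cases K
    · exact inflectionBudget_K_zero m
    · exact inflectionBudget_K_one m
    · exact inflectionBudget_K_two m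

/-! ### §6 (gen 11, v1.2) — the kernel face of the boundary-phase PARITY at K = 3 (memo `negsquares-kink.md` §17.3)

On an arithmetic-progression support at `K = 3` the letters are positive quadratics `qᵢ(u) = aᵢ + bᵢu + cᵢu²` and the
boundary phase `Θ(r) = arg Σᵢ 1/qᵢ(ir)` of memo §17 has `r·|P(ir)|²·∏|qⱼ(ir)|²·Θ′(r) = r·F(r²)` for an explicit real
polynomial `F` of degree `4m−3` whose constant and leading coefficients are both negative; hence `F` has at most `4m−4`
positive roots.  Here: the generic parity lemma (`posRoots_le_natDegree_sub_one_of_odd`) and the case `m = 2` in full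
(`rayF`, its expansion, `posRoots_rayF_le : posRoots (rayF a b c) ≤ 4` = BPL-AP(2,3) of the memo, kernel form).
The analytic chain that turns this into a bound on the inflection count (Aronszajn–Donoghue, Schoenberg) is NOT kernel
material here (memo §17.2, §17.8). -/

/-- Generic parity lemma: a real polynomial of ODD degree whose constant coefficient and leading coefficient are both
negative has at most `natDegree − 1` distinct positive roots (if it had `natDegree` of them it would split with all roots
positive, and then `coeff 0 = lead·(−1)^{odd}·∏ρ > 0`). -/
theorem posRoots_le_natDegree_sub_one_of_odd {P : ℝ[X]} (hodd : Odd P.natDegree) (h0 : P.coeff 0 < 0)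
    (hlead : P.leadingCoeff < 0) : posRoots P ≤ P.natDegree - 1 := by
  have hP : P ≠ 0 := by rintro rfl; simp at h0
  have h1 : (P.roots.toFinset.filter (fun t => 0 < t)).card ≤ P.roots.toFinset.card := Finset.card_filter_le _ _
  have h2 : P.roots.toFinset.card ≤ Multiset.card P.roots := Multiset.toFinset_card_le _
  have h3 : Multiset.card P.roots ≤ P.natDegree := Polynomial.card_roots' P
  unfold posRoots
  by_contra hcon
  rw [not_le] at hcon
  have hn1 : 1 ≤ P.natDegree := hodd.pos
  have heq : (P.roots.toFinset.filter (fun t => 0 < t)).card = P.natDegree := by omega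
  have hcard : Multiset.card P.roots = P.natDegree := by omega
  have hfilt : (P.roots.toFinset.filter (fun t => 0 < t)).card = P.roots.toFinset.card := by omega
  have hpos : ∀ t ∈ P.roots, 0 < t := by
    intro t ht
    have := (Finset.card_filter_eq_iff.mp hfilt) t (Multiset.mem_toFinset.mpr ht)
    exact this
  -- P splits: P = C lead * ∏ (X - C ρ)
  have hsplit := Polynomial.C_leadingCoeff_mul_prod_multiset_X_sub_C hcard
  -- evaluate at 0
  have hev : P.eval 0 = P.leadingCoeff * ((-1) ^ P.natDegree * P.roots.prod) := by
    conv_lhs => rw [← hsplit]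
    rw [Polynomial.eval_mul, Polynomial.eval_C, Polynomial.eval_multiset_prod, Multiset.map_map]
    have : ((fun x => Polynomial.eval 0 x) ∘ fun a => (X : ℝ[X]) - C a) = fun a => -a := by
      funext a; simp
    rw [this, Multiset.prod_map_neg, hcard]
  have hprod : 0 < P.roots.prod := Multiset.prod_pos hpos
  have hodd' : ((-1 : ℝ)) ^ P.natDegree = -1 := hodd.neg_one_pow
  rw [hodd'] at hev
  have : 0 < P.eval 0 := by rw [hev]; nlinarith
  rw [← Polynomial.coeff_zero_eq_eval_zero] at this
  linarith

/-- The two building blocks of the `K = 3` ray polynomial in the variable `s = r²` (memo §17.3): for a quadratic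
`q = a + bu + cu²`, `Im(θq(ir)·conj q(ir)) = r·(rayA a b c)(r²)` and `|q(ir)|² = (rayN a b c)(r²)`. -/
noncomputable def rayA (a b c : ℝ) : ℝ[X] := C b * (C a + C c * X)

/-- `|q(ir)|² = (a − c r²)² + b² r²` as a polynomial in `s = r²`. -/
noncomputable def rayN (a b c : ℝ) : ℝ[X] := (C a - C c * X) ^ 2 + C (b ^ 2) * X

/-- The ray polynomial `F` for TWO quadratics (`m = 2`): `r·F(r²) = A_P·N₀·N₁ − N_P·(A₀N₁ + A₁N₀)` with `P = q₀ + q₁`. -/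
noncomputable def rayF (a b c : Fin 2 → ℝ) : ℝ[X] :=
  rayA (a 0 + a 1) (b 0 + b 1) (c 0 + c 1) * rayN (a 0) (b 0) (c 0) * rayN (a 1) (b 1) (c 1)
    - rayN (a 0 + a 1) (b 0 + b 1) (c 0 + c 1) *
      (rayA (a 0) (b 0) (c 0) * rayN (a 1) (b 1) (c 1) + rayA (a 1) (b 1) (c 1) * rayN (a 0) (b 0) (c 0))

set_option maxHeartbeats 4000000 in
/-- The explicit sextuple of coefficients of `rayF` (degree 5 in `s`). -/
theorem rayF_eq (a b c : Fin 2 → ℝ) : rayF a b c =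
    C (-(a 0 * b 0 * a 1 ^ 4) + -(a 0 ^ 2 * b 0 * a 1 ^ 3) + -(a 0 ^ 3 * a 1 ^ 2 * b 1) + -(a 0 ^ 4 * a 1 * b 1))
    + C (-(b 0 * c 0 * a 1 ^ 4) + b 0 ^ 3 * a 1 ^ 3 + (-2 : ℝ) * a 0 * b 0 * a 1 ^ 2 * b 1 ^ 2 + (4 : ℝ) * a 0 * b 0 * a 1 ^ 3 * c 1 + (-2 : ℝ) * a 0 * b 0 * c 0 * a 1 ^ 3 + (-3 : ℝ) * a 0 * b 0 ^ 2 * a 1 ^ 2 * b 1 + (5 : ℝ) * a 0 ^ 2 * c 0 * a 1 ^ 2 * b 1 + (-3 : ℝ) * a 0 ^ 2 * b 0 * a 1 * b 1 ^ 2 + (5 : ℝ) * a 0 ^ 2 * b 0 * a 1 ^ 2 * c 1 + (-2 : ℝ) * a 0 ^ 2 * b 0 ^ 2 * a 1 * b 1 + a 0 ^ 3 * b 1 ^ 3 + (-2 : ℝ) * a 0 ^ 3 * a 1 * b 1 * c 1 + (4 : ℝ) * a 0 ^ 3 * c 0 * a 1 * b 1 + -(a 0 ^ 4 * b 1 * c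 1)) * X
    + C ((-2 : ℝ) * b 0 * c 0 * a 1 ^ 2 * b 1 ^ 2 + (4 : ℝ) * b 0 * c 0 * a 1 ^ 3 * c 1 + (3 : ℝ) * b 0 * c 0 ^ 2 * a 1 ^ 3 + b 0 ^ 2 * c 0 * a 1 ^ 2 * b 1 + -(b 0 ^ 3 * a 1 * b 1 ^ 2) + -(b 0 ^ 3 * a 1 ^ 2 * c 1) + -(b 0 ^ 4 * a 1 * b 1) + (-7 : ℝ) * a 0 * c 0 ^ 2 * a 1 ^ 2 * b 1 + -(a 0 * b 0 * b 1 ^ 4) + (4 : ℝ) * a 0 * b 0 * a 1 * b 1 ^ 2 * c 1 + (-6 : ℝ) * a 0 * b 0 * a 1 ^ 2 * c 1 ^ 2 + (2 : ℝ) * a 0 * b 0 * c 0 * a 1 * b 1 ^ 2 + (2 : ℝ) * a 0 * b 0 * c 0 * a 1 ^ 2 * c 1 + -(a 0 * b 0 ^ 2 * b 1 ^ 3) + (2 : ℝ) * a 0 * b 0 ^ 2 * a 1 * b 1 * c 1 + (4 : ℝ) * a 0 * b 0 ^ 2 * c 0 * a 1 * b 1 + -(a 0 ^ 2 * c 0 *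 b 1 ^ 3) + (2 : ℝ) * a 0 ^ 2 * c 0 * a 1 * b 1 * c 1 + (-6 : ℝ) * a 0 ^ 2 * c 0 ^ 2 * a 1 * b 1 + a 0 ^ 2 * b 0 * b 1 ^ 2 * c 1 + (-7 : ℝ) * a 0 ^ 2 * b 0 * a 1 * c 1 ^ 2 + (-2 : ℝ) * a 0 ^ 2 * b 0 ^ 2 * b 1 * c 1 + (3 : ℝ) * a 0 ^ 3 * b 1 * c 1 ^ 2 + (4 : ℝ) * a 0 ^ 3 * c 0 * b 1 * c 1) * X ^ 2
    + C ((3 : ℝ) * c 0 ^ 3 * a 1 ^ 2 * b 1 + -(b 0 * c 0 * b 1 ^ 4) + (4 : ℝ) * b 0 * c 0 * a 1 * b 1 ^ 2 * c 1 + (-6 : ℝ) * b 0 * c 0 * a 1 ^ 2 * c 1 ^ 2 + b 0 * c 0 ^ 2 * a 1 * b 1 ^ 2 + (-7 : ℝ) * b 0 * c 0 ^ 2 * a 1 ^ 2 * c 1 + -(b 0 ^ 2 * c 0 * b 1 ^ 3) + (2 : ℝ) * b 0 ^ 2 * c 0 * a 1 * b 1 * c 1 + (-2 : ℝ) * b 0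 ^ 2 * c 0 ^ 2 * a 1 * b 1 + -(b 0 ^ 3 * b 1 ^ 2 * c 1) + -(b 0 ^ 3 * a 1 * c 1 ^ 2) + -(b 0 ^ 4 * b 1 * c 1) + -(a 0 * c 0 ^ 2 * b 1 ^ 3) + (2 : ℝ) * a 0 * c 0 ^ 2 * a 1 * b 1 * c 1 + (4 : ℝ) * a 0 * c 0 ^ 3 * a 1 * b 1 + (-2 : ℝ) * a 0 * b 0 * b 1 ^ 2 * c 1 ^ 2 + (4 : ℝ) * a 0 * b 0 * a 1 * c 1 ^ 3 + (2 : ℝ) * a 0 * b 0 * c 0 * b 1 ^ 2 * c 1 + (2 : ℝ) * a 0 * b 0 * c 0 * a 1 * c 1 ^ 2 + a 0 * b 0 ^ 2 * b 1 * c 1 ^ 2 + (4 : ℝ) * a 0 * b 0 ^ 2 * c 0 * b 1 * c 1 + (-7 : ℝ) * a 0 ^ 2 * c 0 * b 1 * c 1 ^ 2 + (-6 : ℝ) * a 0 ^ 2 * c 0 ^ 2 * b 1 * c 1 + (3 : ℝ) * a 0 ^ 2 * b 0 * c 1 ^ 3) * X ^ 3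
    + C (c 0 ^ 3 * b 1 ^ 3 + (-2 : ℝ) * c 0 ^ 3 * a 1 * b 1 * c 1 + -(c 0 ^ 4 * a 1 * b 1) + (-2 : ℝ) * b 0 * c 0 * b 1 ^ 2 * c 1 ^ 2 + (4 : ℝ) * b 0 * c 0 * a 1 * c 1 ^ 3 + (-3 : ℝ) * b 0 * c 0 ^ 2 * b 1 ^ 2 * c 1 + (5 : ℝ) * b 0 * c 0 ^ 2 * a 1 * c 1 ^ 2 + (-3 : ℝ) * b 0 ^ 2 * c 0 * b 1 * c 1 ^ 2 + (-2 : ℝ) * b 0 ^ 2 * c 0 ^ 2 * b 1 * c 1 + b 0 ^ 3 * c 1 ^ 3 + (5 : ℝ) * a 0 * c 0 ^ 2 * b 1 * c 1 ^ 2 + (4 : ℝ) * a 0 * c 0 ^ 3 * b 1 * c 1 + -(a 0 * b 0 * c 1 ^ 4) + (-2 : ℝ) * a 0 * b 0 * c 0 * c 1 ^ 3) * X ^ 4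
    + C (-(c 0 ^ 3 * b 1 * c 1 ^ 2) + -(c 0 ^ 4 * b 1 * c 1) + -(b 0 * c 0 * c 1 ^ 4) + -(b 0 * c 0 ^ 2 * c 1 ^ 3)) * X ^ 5 := by
  simp only [rayF, rayA, rayN, map_add, map_mul, map_neg, map_pow, map_ofNat]
  ring

/-- Constant coefficient: `F(0) = −(a₀+a₁)a₀a₁(a₀²b₁ + a₁²b₀)`. -/
theorem rayF_coeff_zero (a b c : Fin 2 → ℝ) :
    (rayF a b c).coeff 0 = -((a 0 + a 1) * a 0 * a 1 * (a 0 ^ 2 * b 1 + a 1 ^ 2 * b 0)) := by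
  rw [rayF_eq]
  simp only [coeff_add, coeff_C_mul, coeff_X_pow, coeff_C_zero, coeff_X_zero, mul_zero, add_zero]
  norm_num; ring

/-- Leading coefficient: `F₅ = −(c₀+c₁)c₀c₁(c₀²b₁ + c₁²b₀)`. -/
theorem rayF_coeff_five (a b c : Fin 2 → ℝ) :
    (rayF a b c).coeff 5 = -((c 0 + c 1) * c 0 * c 1 * (c 0 ^ 2 * b 1 + c 1 ^ 2 * b 0)) := by
  rw [rayF_eq]
  simp only [coeff_add, coeff_C_mul, coeff_X_pow, coeff_C, coeff_X]
  norm_num; ring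

theorem rayF_natDegree_le (a b c : Fin 2 → ℝ) : (rayF a b c).natDegree ≤ 5 := by
  rw [rayF_eq]; compute_degree!

/-- **BPL-AP(2,3), kernel form (memo §17.3 at m = 2).**  For two positive quadratics the ray polynomial has at most
four distinct positive roots: degree `5`, both end coefficients negative, parity. -/
theorem posRoots_rayF_le (a b c : Fin 2 → ℝ) (ha : ∀ i, 0 < a i) (hb : ∀ i, 0 < b i) (hc : ∀ i, 0 < c i) :
    posRoots (rayF a b c) ≤ 4 := by
  have ha0 := ha 0; have ha1 := ha 1; have hb0 := hb 0; have hb1 := hb 1; have hc0 := hc 0; have hc1 := hc 1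
  have hq0 : 0 < (a 0 + a 1) * a 0 * a 1 * (a 0 ^ 2 * b 1 + a 1 ^ 2 * b 0) := by positivity
  have hq5 : 0 < (c 0 + c 1) * c 0 * c 1 * (c 0 ^ 2 * b 1 + c 1 ^ 2 * b 0) := by positivity
  have h0 : (rayF a b c).coeff 0 < 0 := by rw [rayF_coeff_zero]; linarith
  have h5 : (rayF a b c).coeff 5 < 0 := by rw [rayF_coeff_five]; linarith
  have hdeg : (rayF a b c).natDegree = 5 :=
    le_antisymm (rayF_natDegree_le a b c) (Polynomial.le_natDegree_of_ne_zero (ne_of_lt h5))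
  have hlead : (rayF a b c).leadingCoeff < 0 := by rw [Polynomial.leadingCoeff, hdeg]; exact h5
  have hodd : Odd (rayF a b c).natDegree := by rw [hdeg]; exact ⟨2, by norm_num⟩
  have := posRoots_le_natDegree_sub_one_of_odd hodd h0 hlead
  rw [hdeg] at this
  exact this

/-! ## §7 (gen 12, v1.3) The MEAN-CROSSING LAW `MC(K)` (LAP LAW): kernel proofs at `K ≤ 3`, the balance identity (memo `negsquares-kink.md` §19.2–19.3). -/

/-- The Euler–Wronskian of two letters, `θq₀ · q₁ − q₀ · θq₁`: at `t > 0` its sign is the sign of `m₀(t) − m₁(t)`, the difference of the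
tilted means of the exponent under the two letters (`mᵢ = θqᵢ/qᵢ`). -/
noncomputable def meanWr (q₀ q₁ : ℝ[X]) : ℝ[X] := thetaOp q₀ * q₁ - q₀ * thetaOp q₁

/-- **MC(K) — the mean-crossing law / LAP LAW (memo `negsquares-kink.md` §19.3).**  For two positive letters on a common support of size `K`
with strictly increasing exponents, the tilted means cross at most `K − 2` times on `(0,∞)`: the Euler–Wronskian has at most `K − 2` distinct
positive roots, so `u = log(q₀/q₁)(eˣ)` has at most `K − 1` monotone laps.  STATUS: a THEOREM ON PAPER for every `K` and every real support, in the
sharper form «zeros of `W` on `(0,∞)` counting multiplicity ≤ S⁻(ρ₂−ρ₁, …, ρ_K−ρ_{K−1})», `ρ_l = p l 0 / p l 1` (memo §19.3: `∂ₓE_x[ρ] = Σ_k Δρ_k·∂ₓP_x(l ≥ k)`,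
the coefficient matrix of the block sums is totally positive, Cauchy–Binet makes `(Z, v₁, …, v_{s+1})` an ECT-system, the Wronskian identity
`W(v₀,…,v_j) = v₀^{j+1}·W((v₁/v₀)′,…)` passes ECT to the reduced system, and Pólya's ECT zero bound finishes); KERNEL below for `K ≤ 3`
(`meanCrossingLaw_two`, `meanCrossingLaw_three` — Descartes on the three ordered pair-sums).  It does NOT by itself give `InflectionBudget 2 K`
(two islands in one lap occur, memo §19.4 (c)). -/
def MeanCrossingLaw (K : ℕ) : Prop :=
  ∀ (d : Fin K → ℕ) (p : Fin K → Fin 2 → ℝ), StrictMono d → (∀ l i, 0 < p l i) →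
    posRoots (meanWr (letterPoly d p 0) (letterPoly d p 1)) ≤ K - 2

/-- `n · (t · t^{n−1}) = n · t^n` for every natural `n` (both sides vanish at `n = 0`). -/
private theorem natCast_mul_mul_pow_pred (n : ℕ) (t : ℝ) : (n : ℝ) * (t * t ^ (n - 1)) = n * t ^ n := by
  rcases n with _ | n
  · simp
  · simp [pow_succ, mul_comm]

/-- Evaluation of the derivative of a letter: `(q i)'(t) = Σ_l p l i · d l · t^{d l − 1}`. -/
theorem derivative_letterPoly_eval (d : Fin K → ℕ) (p : Fin K → Fin m → ℝ) (i : Fin m) (t : ℝ) :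
    (derivative (letterPoly d p i)).eval t = ∑ l, p l i * ((d l : ℝ) * t ^ (d l - 1)) := by
  simp [letterPoly, Polynomial.derivative_X_pow, eval_finsetSum]

/-- Evaluation of `θ` of a letter: `θ(q i)(t) = Σ_l d l · p l i · t^{d l}`. -/
theorem thetaOp_letterPoly_eval (d : Fin K → ℕ) (p : Fin K → Fin m → ℝ) (i : Fin m) (t : ℝ) :
    (thetaOp (letterPoly d p i)).eval t = ∑ l, (d l : ℝ) * p l i * t ^ d l := by
  rw [eval_thetaOp, derivative_letterPoly_eval, Finset.mul_sum]
  refine Finset.sum_congr rfl fun l _ => ?_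
  have := natCast_mul_mul_pow_pred (d l) t
  calc t * (p l i * ((d l : ℝ) * t ^ (d l - 1))) = p l i * ((d l : ℝ) * (t * t ^ (d l - 1))) := by ring
    _ = p l i * ((d l : ℝ) * t ^ d l) := by rw [this]
    _ = (d l : ℝ) * p l i * t ^ d l := by ring

/-- The Euler–Wronskian of two letters evaluated: `Σ_a Σ_b (d a − d b) · p a 0 · p b 1 · t^{d a + d b}`. -/
theorem meanWr_letterPoly_eval (d : Fin K → ℕ) (p : Fin K → Fin 2 → ℝ) (t : ℝ) :
    (meanWr (letterPoly d p 0) (letterPoly d p 1)).eval t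
      = ∑ a, ∑ b, ((d a : ℝ) - d b) * p a 0 * p b 1 * t ^ (d a + d b) := by
  simp only [meanWr, eval_sub, eval_mul, thetaOp_letterPoly_eval, letterPoly_eval, Finset.sum_mul_sum,
    ← Finset.sum_sub_distrib]
  refine Finset.sum_congr rfl fun a _ => Finset.sum_congr rfl fun b _ => ?_
  rw [pow_add]; ring

/-- The three-term form at `K = 3`: with `c_{ab} := (d b − d a)(p b 0 · p a 1 − p a 0 · p b 1)`,
`W(t) = c₀₁ t^{d 0 + d 1} + c₀₂ t^{d 0 + d 2} + c₁₂ t^{d 1 + d 2}`. -/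
theorem meanWr_letterPoly_eval_three (d : Fin 3 → ℕ) (p : Fin 3 → Fin 2 → ℝ) (t : ℝ) :
    (meanWr (letterPoly d p 0) (letterPoly d p 1)).eval t
      = ((d 1 : ℝ) - d 0) * (p 1 0 * p 0 1 - p 0 0 * p 1 1) * t ^ (d 0 + d 1)
        + ((d 2 : ℝ) - d 0) * (p 2 0 * p 0 1 - p 0 0 * p 2 1) * t ^ (d 0 + d 2)
        + ((d 2 : ℝ) - d 1) * (p 2 0 * p 1 1 - p 1 0 * p 2 1) * t ^ (d 1 + d 2) := by
  rw [meanWr_letterPoly_eval]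
  simp only [Fin.sum_univ_three]
  have h10 : d 1 + d 0 = d 0 + d 1 := add_comm _ _
  have h20 : d 2 + d 0 = d 0 + d 2 := add_comm _ _
  have h21 : d 2 + d 1 = d 1 + d 2 := add_comm _ _
  rw [h10, h20, h21]
  ring

/-- Transitivity of the ratio order `ρ_l = p l 0 / p l 1`, cross-multiplied: `ρ_b < ρ_a` and `ρ_c < ρ_b` give `ρ_c < ρ_a`. -/
private theorem cross_ratio_trans {a₀ a₁ b₀ b₁ c₀ c₁ : ℝ} (ha₁ : 0 < a₁) (hb₀ : 0 < b₀) (hb₁ : 0 < b₁) (hc₀ : 0 < c₀)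
    (h₁ : b₀ * a₁ < a₀ * b₁) (h₂ : c₀ * b₁ < b₀ * c₁) : c₀ * a₁ < a₀ * c₁ := by
  have hm := mul_lt_mul'' h₁ h₂ (by positivity) (by positivity)
  -- (b₀ a₁)(c₀ b₁) < (a₀ b₁)(b₀ c₁); divide by b₀ b₁ > 0
  have hbb : 0 < b₀ * b₁ := mul_pos hb₀ hb₁
  have : b₀ * b₁ * (c₀ * a₁) < b₀ * b₁ * (a₀ * c₁) := by nlinarith [hm]
  exact lt_of_mul_lt_mul_left this hbb.le

/-- **MC(3): the tilted means of two positive trinomials on a common support cross at most once on `(0,∞)`**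
(every support with strictly increasing exponents; memo §19.3).  Proof: the pair-sums `d0+d1 < d0+d2 < d1+d2` are ordered and the
coefficient signs `sgn(ρ₁−ρ₀), sgn(ρ₂−ρ₀), sgn(ρ₂−ρ₁)` change at most once in that order; after division by `t^{d0+d2}` the Wronskian is
`c₀₁·t^{−(d2−d1)} + c₀₂ + c₁₂·t^{d1−d0}`, strictly monotone when `c₀₁ ≤ 0 ≤ c₁₂` or `c₁₂ ≤ 0 ≤ c₀₁` (not both zero), and `W` has constant
sign on `(0,∞)` otherwise. -/
theorem meanCrossingLaw_three : MeanCrossingLaw 3 := by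
  intro d p hd hp
  show posRoots _ ≤ 1
  set W := meanWr (letterPoly d p 0) (letterPoly d p 1) with hW
  have hd01 : d 0 < d 1 := hd (by decide)
  have hd12 : d 1 < d 2 := hd (by decide)
  have hd02 : d 0 < d 2 := hd01.trans hd12
  have hr01 : (d 0 : ℝ) < d 1 := by exact_mod_cast hd01
  have hr12 : (d 1 : ℝ) < d 2 := by exact_mod_cast hd12
  have hr02 : (d 0 : ℝ) < d 2 := by exact_mod_cast hd02
  obtain ⟨c₀₁, hc₀₁⟩ : ∃ c : ℝ, c = ((d 1 : ℝ) - d 0) * (p 1 0 * p 0 1 - p 0 0 * p 1 1) := ⟨_, rfl⟩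
  obtain ⟨c₀₂, hc₀₂⟩ : ∃ c : ℝ, c = ((d 2 : ℝ) - d 0) * (p 2 0 * p 0 1 - p 0 0 * p 2 1) := ⟨_, rfl⟩
  obtain ⟨c₁₂, hc₁₂⟩ : ∃ c : ℝ, c = ((d 2 : ℝ) - d 1) * (p 2 0 * p 1 1 - p 1 0 * p 2 1) := ⟨_, rfl⟩
  have hev : ∀ t : ℝ, W.eval t = c₀₁ * t ^ (d 0 + d 1) + c₀₂ * t ^ (d 0 + d 2) + c₁₂ * t ^ (d 1 + d 2) := fun t => by
    rw [hW, meanWr_letterPoly_eval_three, hc₀₁, hc₀₂, hc₁₂]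
  have hp00 := hp 0 0; have hp01 := hp 0 1; have hp10 := hp 1 0; have hp11 := hp 1 1; have hp20 := hp 2 0; have hp21 := hp 2 1
  -- exponents of the normalised form
  obtain ⟨B, hB⟩ : ∃ B : ℕ, B = d 2 - d 1 := ⟨_, rfl⟩
  obtain ⟨A, hA⟩ : ∃ A : ℕ, A = d 1 - d 0 := ⟨_, rfl⟩
  have hBpos : B ≠ 0 := by omega
  have hApos : A ≠ 0 := by omega
  -- the normalised function h(t) = c₀₁ · (t^B)⁻¹ + c₀₂ + c₁₂ · t^A
  have hnorm : ∀ t : ℝ, 0 < t → W.eval t = t ^ (d 0 + d 2) * (c₀₁ * (t ^ B)⁻¹ + c₀₂ + c₁₂ * t ^ A) := fun t ht => by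
    rw [hev]
    have h1 : t ^ (d 0 + d 2) = t ^ (d 0 + d 1) * t ^ B := by rw [← pow_add]; congr 1; omega
    have h2 : t ^ (d 1 + d 2) = t ^ (d 0 + d 2) * t ^ A := by rw [← pow_add]; congr 1; omega
    have hne : t ^ B ≠ 0 := pow_ne_zero _ ht.ne'
    have hBinv : t ^ B * (t ^ B)⁻¹ = 1 := mul_inv_cancel₀ hne
    rw [h2, h1]
    linear_combination (-(c₀₁ * t ^ (d 0 + d 1))) * hBinv
  -- monotonicity of the two moving pieces on (0,∞)
  have recip_anti : ∀ {s t : ℝ}, 0 < s → s < t → (t ^ B)⁻¹ < (s ^ B)⁻¹ := fun {s t} hs hst =>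
    (inv_lt_inv₀ (pow_pos (hs.trans hst) _) (pow_pos hs _)).2 (pow_lt_pow_left₀ hst hs.le hBpos)
  have pow_mono : ∀ {s t : ℝ}, 0 < s → s < t → s ^ A < t ^ A := fun {s t} hs hst =>
    pow_lt_pow_left₀ hst hs.le hApos
  -- h increasing when c₀₁ ≤ 0 ≤ c₁₂ (not both zero), decreasing when c₁₂ ≤ 0 ≤ c₀₁ (not both zero)
  have hincr : c₀₁ ≤ 0 → 0 ≤ c₁₂ → (c₀₁ ≠ 0 ∨ c₁₂ ≠ 0) → ∀ {s t : ℝ}, 0 < s → s < t →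
      c₀₁ * (s ^ B)⁻¹ + c₀₂ + c₁₂ * s ^ A < c₀₁ * (t ^ B)⁻¹ + c₀₂ + c₁₂ * t ^ A := by
    intro h01 h12 hnz s t hs hst
    have r := recip_anti hs hst
    have q := pow_mono hs hst
    have e1 : c₀₁ * (s ^ B)⁻¹ ≤ c₀₁ * (t ^ B)⁻¹ := mul_le_mul_of_nonpos_left r.le h01
    have e2 : c₁₂ * s ^ A ≤ c₁₂ * t ^ A := mul_le_mul_of_nonneg_left q.le h12
    rcases hnz with h | h
    · have s01 : c₀₁ < 0 := lt_of_le_of_ne h01 h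
      have : c₀₁ * (s ^ B)⁻¹ < c₀₁ * (t ^ B)⁻¹ := mul_lt_mul_of_neg_left r s01
      linarith
    · have s12 : 0 < c₁₂ := lt_of_le_of_ne h12 (Ne.symm h)
      have : c₁₂ * s ^ A < c₁₂ * t ^ A := mul_lt_mul_of_pos_left q s12
      linarith
  have hdecr : c₁₂ ≤ 0 → 0 ≤ c₀₁ → (c₀₁ ≠ 0 ∨ c₁₂ ≠ 0) → ∀ {s t : ℝ}, 0 < s → s < t →
      c₀₁ * (t ^ B)⁻¹ + c₀₂ + c₁₂ * t ^ A < c₀₁ * (s ^ B)⁻¹ + c₀₂ + c₁₂ * s ^ A := by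
    intro h12 h01 hnz s t hs hst
    have r := recip_anti hs hst
    have q := pow_mono hs hst
    have e1 : c₀₁ * (t ^ B)⁻¹ ≤ c₀₁ * (s ^ B)⁻¹ := mul_le_mul_of_nonneg_left r.le h01
    have e2 : c₁₂ * t ^ A ≤ c₁₂ * s ^ A := mul_le_mul_of_nonpos_left q.le h12
    rcases hnz with h | h
    · have s01 : 0 < c₀₁ := lt_of_le_of_ne h01 (Ne.symm h)
      have : c₀₁ * (t ^ B)⁻¹ < c₀₁ * (s ^ B)⁻¹ := mul_lt_mul_of_pos_left r s01
      linarith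
    · have s12 : c₁₂ < 0 := lt_of_le_of_ne h12 h
      have : c₁₂ * t ^ A < c₁₂ * s ^ A := mul_lt_mul_of_neg_left q s12
      linarith
  -- the ratio order: c₀₁ and c₁₂ of the same strict sign force c₀₂ to have that sign
  have hneg : c₀₁ ≤ 0 → c₁₂ < 0 → c₀₂ < 0 := by
    intro h01 h12
    have r12 : p 2 0 * p 1 1 < p 1 0 * p 2 1 := by
      by_contra hcon
      have : 0 ≤ c₁₂ := by rw [hc₁₂]; exact mul_nonneg (by linarith) (by linarith)
      linarith
    have r01 : p 1 0 * p 0 1 ≤ p 0 0 * p 1 1 := by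
      by_contra hcon
      have : 0 < c₀₁ := by rw [hc₀₁]; exact mul_pos (by linarith) (by linarith)
      linarith
    have r02 : p 2 0 * p 0 1 < p 0 0 * p 2 1 := by
      rcases eq_or_lt_of_le r01 with e | s
      · -- ρ₁ = ρ₀
        have h1 : p 0 1 * (p 2 0 * p 1 1) < p 0 1 * (p 1 0 * p 2 1) := mul_lt_mul_of_pos_left r12 hp01
        have h2 : p 0 1 * (p 1 0 * p 2 1) = p 1 1 * (p 0 0 * p 2 1) := by linear_combination (p 2 1) * e
        have h3 : p 1 1 * (p 2 0 * p 0 1) < p 1 1 * (p 0 0 * p 2 1) := by nlinarith [h1, h2]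
        exact lt_of_mul_lt_mul_left h3 hp11.le
      · exact cross_ratio_trans hp01 hp10 hp11 hp20 s r12
    rw [hc₀₂]; exact mul_neg_of_pos_of_neg (by linarith) (by linarith)
  have hposc : 0 < c₀₁ → 0 ≤ c₁₂ → 0 < c₀₂ := by
    intro h01 h12
    have r01 : p 0 0 * p 1 1 < p 1 0 * p 0 1 := by
      by_contra hcon
      have : c₀₁ ≤ 0 := by rw [hc₀₁]; exact mul_nonpos_of_nonneg_of_nonpos (by linarith) (by linarith)
      linarith
    have r12 : p 1 0 * p 2 1 ≤ p 2 0 * p 1 1 := by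
      by_contra hcon
      have : c₁₂ < 0 := by rw [hc₁₂]; exact mul_neg_of_pos_of_neg (by linarith) (by linarith)
      linarith
    have r02 : p 0 0 * p 2 1 < p 2 0 * p 0 1 := by
      rcases eq_or_lt_of_le r12 with e | s
      · have h1 : p 2 1 * (p 0 0 * p 1 1) < p 2 1 * (p 1 0 * p 0 1) := mul_lt_mul_of_pos_left r01 hp21
        have h2 : p 2 1 * (p 1 0 * p 0 1) = p 1 1 * (p 2 0 * p 0 1) := by linear_combination (p 0 1) * e
        have h3 : p 1 1 * (p 0 0 * p 2 1) < p 1 1 * (p 2 0 * p 0 1) := by nlinarith [h1, h2]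
        exact lt_of_mul_lt_mul_left h3 hp11.le
      · -- ρ₀ < ρ₁ and ρ₁ < ρ₂: transitivity with the two letters exchanged
        exact cross_ratio_trans hp21 hp10 hp11 hp00 s r01
    rw [hc₀₂]; exact mul_pos (by linarith) (by linarith)
  -- counting
  unfold posRoots
  rw [Finset.card_le_one]
  intro a ha b hb
  rw [Finset.mem_filter, Multiset.mem_toFinset] at ha hb
  by_cases hW0 : W = 0
  · rw [hW0] at ha; simp at ha
  have hra : W.eval a = 0 := (mem_roots hW0).1 ha.1
  have hrb : W.eval b = 0 := (mem_roots hW0).1 hb.1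
  have hapos : 0 < a := ha.2
  have hbpos : 0 < b := hb.2
  have hha : c₀₁ * (a ^ B)⁻¹ + c₀₂ + c₁₂ * a ^ A = 0 := by
    have h := hnorm a hapos; rw [hra] at h
    exact (mul_eq_zero.1 h.symm).resolve_left (pow_pos hapos _).ne'
  have hhb : c₀₁ * (b ^ B)⁻¹ + c₀₂ + c₁₂ * b ^ A = 0 := by
    have h := hnorm b hbpos; rw [hrb] at h
    exact (mul_eq_zero.1 h.symm).resolve_left (pow_pos hbpos _).ne'
  -- if c₀₁ = c₁₂ = 0 then c₀₂ = 0 and W = 0: excluded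
  have hnz : c₀₁ ≠ 0 ∨ c₁₂ ≠ 0 := by
    by_contra hcon
    simp only [ne_eq, not_or, not_not] at hcon
    obtain ⟨e01, e12⟩ := hcon
    have e02 : c₀₂ = 0 := by simpa [e01, e12] using hha
    apply hW0
    apply Polynomial.funext
    intro t
    rw [hev, e01, e02, e12]; simp
  by_contra hab
  -- four sign cases
  rcases le_or_gt c₀₁ 0 with h01 | h01 <;> rcases le_or_gt 0 c₁₂ with h12 | h12
  · -- c₀₁ ≤ 0 ≤ c₁₂ : strictly increasing
    rcases lt_or_gt_of_ne hab with hlt | hlt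
    · have := hincr h01 h12 hnz hapos hlt; linarith
    · have := hincr h01 h12 hnz hbpos hlt; linarith
  · -- c₀₁ ≤ 0, c₁₂ < 0 : W < 0 on (0,∞)
    have hc02 := hneg h01 h12
    have : W.eval a < 0 := by
      rw [hev]
      have t1 : c₀₁ * a ^ (d 0 + d 1) ≤ 0 := mul_nonpos_of_nonpos_of_nonneg h01 (pow_pos hapos _).le
      have t2 : c₀₂ * a ^ (d 0 + d 2) < 0 := mul_neg_of_neg_of_pos hc02 (pow_pos hapos _)
      have t3 : c₁₂ * a ^ (d 1 + d 2) < 0 := mul_neg_of_neg_of_pos h12 (pow_pos hapos _)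
      linarith
    linarith
  · -- 0 < c₀₁, 0 ≤ c₁₂ : W > 0 on (0,∞)
    have hc02 := hposc h01 h12
    have : 0 < W.eval a := by
      rw [hev]
      have t1 : 0 < c₀₁ * a ^ (d 0 + d 1) := mul_pos h01 (pow_pos hapos _)
      have t2 : 0 < c₀₂ * a ^ (d 0 + d 2) := mul_pos hc02 (pow_pos hapos _)
      have t3 : 0 ≤ c₁₂ * a ^ (d 1 + d 2) := mul_nonneg h12 (pow_pos hapos _).le
      linarith
    linarith
  · -- 0 < c₀₁, c₁₂ < 0 : strictly decreasing
    rcases lt_or_gt_of_ne hab with hlt | hlt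
    · have := hdecr h12.le h01.le hnz hapos hlt; linarith
    · have := hdecr h12.le h01.le hnz hbpos hlt; linarith


/-- `MC(2)`: on a two-element support the Euler–Wronskian is a single monomial `c·X^{d0+d1}` — no positive root (or `W = 0`). -/
theorem meanCrossingLaw_two : MeanCrossingLaw 2 := by
  intro d p hd hp
  show posRoots _ ≤ 0
  set W := meanWr (letterPoly d p 0) (letterPoly d p 1) with hW
  obtain ⟨c, hc⟩ : ∃ c : ℝ, c = ((d 1 : ℝ) - d 0) * (p 1 0 * p 0 1 - p 0 0 * p 1 1) := ⟨_, rfl⟩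
  have hev : ∀ t : ℝ, W.eval t = c * t ^ (d 0 + d 1) := fun t => by
    rw [hW, meanWr_letterPoly_eval]
    simp only [Fin.sum_univ_two]
    rw [hc, add_comm (d 1) (d 0)]; ring
  by_cases h0 : c = 0
  · have : W = 0 := Polynomial.funext fun t => by rw [hev, h0]; simp
    rw [this, posRoots_zero]
  · rw [posRoots_eq_zero_of_eval_ne_zero W fun t ht => by rw [hev]; exact mul_ne_zero h0 (pow_ne_zero _ ht.ne')]

/-- **The balance form of the sum-letter excess (memo §19.1–19.2), as polynomial algebra.**
`E(q₀,q₁) = q₀q₁ · W(q₀,q₁)² − (q₀ + q₁)·(q₁³·Λq₀ + q₀³·Λq₁)` with `W = meanWr`, `Λ = lagVar`; dividing by `q₀²q₁²(q₀+q₁)²` at `t > 0` this is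
`H'' = σ(1−σ)·(m₀−m₁)² − (1−σ)·V₀ − σ·V₁`, `σ = q₀/(q₀+q₁)` (law of total variance for the tilted mixture).  The exponentially SMALLER letter
has its variance weighted UP by `e^{|u|}` — the coupling that kills the nesting mechanism refuting the decoupled law (memo §19.1). -/
theorem sumLetterExcess_eq_balance (q₀ q₁ : ℝ[X]) :
    sumLetterExcess q₀ q₁ = q₀ * q₁ * meanWr q₀ q₁ ^ 2 - (q₀ + q₁) * (q₁ ^ 3 * lagVar q₀ + q₀ ^ 3 * lagVar q₁) := by
  simp only [sumLetterExcess, lagVar, meanWr, thetaOp, derivative_mul, derivative_add, derivative_X]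
  ring

/-- On `(0,∞)` the excess of two positive letters (support of size `≥ 2`) is STRICTLY below `q₀q₁·W²`. -/
theorem sumLetterExcess_eval_lt (d : Fin K → ℕ) (p : Fin K → Fin 2 → ℝ) (hK : 2 ≤ K) (hd : StrictMono d)
    (hp : ∀ l i, 0 < p l i) {t : ℝ} (ht : 0 < t) :
    (sumLetterExcess (letterPoly d p 0) (letterPoly d p 1)).eval t
      < (letterPoly d p 0).eval t * (letterPoly d p 1).eval t * ((meanWr (letterPoly d p 0) (letterPoly d p 1)).eval t) ^ 2 := by
  have hid := congrArg (Polynomial.eval t) (sumLetterExcess_eq_balance (letterPoly d p 0) (letterPoly d p 1))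
  simp only [eval_sub, eval_mul, eval_add, eval_pow] at hid
  have h0 := letterPoly_eval_pos d p (by omega) hp 0 ht
  have h1 := letterPoly_eval_pos d p (by omega) hp 1 ht
  have hL0 := lagVar_letterPoly_eval_pos d p hK hd hp 0 ht
  have hL1 := lagVar_letterPoly_eval_pos d p hK hd hp 1 ht
  rw [hid]
  set a := (letterPoly d p 0).eval t
  set b := (letterPoly d p 1).eval t
  set L₀ := (lagVar (letterPoly d p 0)).eval t
  set L₁ := (lagVar (letterPoly d p 1)).eval t
  have hab : 0 < a + b := add_pos h0 h1
  have hin : 0 < b ^ 3 * L₀ + a ^ 3 * L₁ := add_pos (mul_pos (pow_pos h1 3) hL0) (mul_pos (pow_pos h0 3) hL1)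
  have := mul_pos hab hin
  linarith

/-- **Islands lie inside `{W ≠ 0}` (memo §19.2):** where the sum-letter excess is positive the tilted means differ, so `u = log(q₀/q₁)(eˣ)` is
strictly monotone on every island of `{H'' > 0}`; with `MC(K)` the islands are distributed over at most `K − 1` monotone laps of `u`
(but a lap can carry two islands — memo §19.4 (c) — so this is NOT yet `InflectionBudget 2 K`). -/
theorem meanWr_eval_ne_zero_of_excess_pos (d : Fin K → ℕ) (p : Fin K → Fin 2 → ℝ) (hK : 2 ≤ K) (hd : StrictMono d)
    (hp : ∀ l i, 0 < p l i) {t : ℝ} (ht : 0 < t)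
    (hE : 0 < (sumLetterExcess (letterPoly d p 0) (letterPoly d p 1)).eval t) :
    (meanWr (letterPoly d p 0) (letterPoly d p 1)).eval t ≠ 0 := by
  intro hW
  have := sumLetterExcess_eval_lt d p hK hd hp ht
  rw [hW] at this
  have : (sumLetterExcess (letterPoly d p 0) (letterPoly d p 1)).eval t < 0 := by simpa using this
  linarith


end Commuting

end Summit.ValiantsHypothesis.ValiantsHypothesis.Cruxes.MatrixDescartes.NegSquaresInflection
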